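import Summits.BirchSwinnertonDyer.BirchSwinnertonDyer.Theses.ClassRecordThree
import Summits.BirchSwinnertonDyer.BirchSwinnertonDyer.Theses.KolyvaginRoadThree
import Summits.BirchSwinnertonDyer.BirchSwinnertonDyer.Theorems.ClassRecordThreeEulerHalvesAtThreeMonoCarrierPrint
import Summits.BirchSwinnertonDyer.BirchSwinnertonDyer.Theorems.KimAtThreeD7uTamagawaSharpTowerLe
import Summits.BirchSwinnertonDyer.BirchSwinnertonDyer.Theorems.KimAtThreeD7uTamagawaKuriharaTower
import Summits.BirchSwinnertonDyer.BirchSwinnertonDyer.Theorems.ClassRecordThreeEulerHalvesAtThreeOfExceptionalZeroRoad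
import Literature.NumberTheory.EllipticCurves.Rank1Residual.Typed.HigherDescentCertificate
import Literature.NumberTheory.EllipticCurves.CanonicalPAdicHeightThetaProofs
import Literature.NumberTheory.EllipticCurves.PadicFormalLogOrder
import HarnessLib

set_option linter.dupNamespace false

/-!
# Crux 19109 `EulerHalvesAtThree` — LINE `katodefect`: the FINITE-LEVEL KATO ROAD on the
# two-carrier `{3, ℓ}` frames (Mazur–Rubin ∕ Sakamoto ∕ Büyükboduk at `p = 3`, split multiplicative `3`,
# analytic rank one), seat `bsd-idea-10` (lens = transfer) gen 2–3; card `Ideas/kato-defect-one-carrier.md`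
# (critic V2 PASS-WITH-PRICE; line V11/V16 PASS-WITH-PRICE).  A SKELETON: `sorry` only inside `stub_*`; the
# composition `EulerHalvesAtThree_of` is kernel-checked and concludes the route decl BY NAME.  Nothing is booked,
# no census word moves, BSD is not proved by any of this.
# **v4 (gen 3 — critic V16 standing price P1 PAID, §1b):** the v3.1 stub S1 is now the CARRIER `KatoZetaData`
# (the binders of the named fact `Kato2004.exists_eulerSystem_expStar_values`, inhabited: `nonempty_katoZetaData`)
# + **S1a PROVED** (`katoKolyvaginSystemAtThree_named`: Kato's Kolyvagin system for `𝓕_u` with bottom class BY NAME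
# `res κ_∅ = Φ(z_ℚ mod 3^{K+1})`, THEOREM D-u of part XXIII applied to (C1)+(C2)) + stub **S1b** (THE BET, typed
# Φ-free: the `3`-divisibility INDEX of Kato's `z_ℚ ∈ H¹(ℚ, T₃E)` is `≤ i + v₃(c_ℓ) + v₃(#Ш_an)`) + stub **S1c**
# (folklore finite-level reading of the index); the old S1 is the PROVED corollary `katoDerivedClassAtThree`.
# Stubs: S2 (L), S1b (XL, hardest), S1c (M), R (residual), F (print) — 5 `sorry`, all inside `stub_*`.
# **v5 (gen 4 — critic V22 P2⁗, the DOCKING RE-CUT):** S1b is now PROVED (`katoIndexBoundAtThree_of_docking`) from two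
# stubs — **S1b₀** `stub_katoDockingLawAtThree` (THE BET, the ONE literature-shaped input: the index bound in the currency of
# `v₃ log_E(P)`, i.e. Venerucci's rank-one reciprocity law at `p = 3` + the constant audit + Kato-side saturation, card §v5) and
# **S1b₁** `stub_localLogIndexAtThree` (M, local Tate curve: `v₃ log_E(P) = i + 1 − v₃(c₃)` on the population, over the tree's
# `padicLogOrd`).  Stubs: S2 (L), S1b₀ (XL bet), S1b₁ (M), S1c (M), R (residual), F (print) — 6 `sorry`, all inside `stub_*`.
# v5.1 (critic V27 P1/P3): S1b₀ quantified `∃ 𝔎, ∀ w P` (the datum does not depend on the point); `linter.dupNamespace` off.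

## The line in one paragraph

On a (ram) X11b@3 curve `E` with `3` SPLIT multiplicative and exactly ONE Tamagawa-`3` carrier `ℓ ∤ 3`
(`v₃(c_ℓ) = n + 1`, every other finite `v ∤ 3` has `3 ∤ c_v`; the `3 ∣ c₃` of shape (α) is allowed and
is the point), work with `T = E[3^{k+1}]` over `R = ℤ/3^{k+1}` and the tree's Kolyvagin-system
vocabulary (`KolyvaginDatum`, `kolyvaginSystems`, `𝓕_can = propagatedSelmerStructure W 3 k`,
`𝓕_u = blochKatoSelmerStructure 3 (tateTorsionDatum W 3 k) ⊤`):
(S2) every Kolyvagin system `λ` for `𝓕_can` has `v₃(ord λ_∅) + i + v₃ #Ш[3^∞] ≤ k + 1`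
  (Sakamoto 2024 Thm. 4.4 (1)+(2) at `d = ∅` — tree facts `Sakamoto2024.kolyvaginSystems_freeRankOne_zmod_three_pow`
  ∕ `…idealOfBasis_eq_fittingIdeal_zmod_three_pow`, their `m = 1` slices PROVED (`SakamotoRankOneAtOne`,
  `SakamotoFittingAtOne`) — plus the bookkeeping `#H¹_{𝓕_can^*}(ℚ, E[3^{k+1}]) = 3^i · #Ш[3^∞]`, `3^i` the
  local index of `E(ℚ)` in `E(ℚ₃)`, `k ≫ 0`);
(S3) every Kolyvagin system for `𝓕_u` on `E[3^{k+n+2}]` is `incl_*` of one for `𝓕_can` on `E[3^{k+1}]`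
  (the TAMAGAWA DEFECT at the ONE carrier `ℓ`, `3^{n+1} ∣ c_ℓ`: the tree's TOOL theorem
  `KimAtThreeD7uTamagawaSharp.exists_isKolyvaginSystem_map_torsionInclusion_eq_add_le`, PROVED below from it —
  NOT a stub);
(S1 = v4: S1a PROVED + S1b THE BET + S1c, §1b) Kato's Kolyvagin system at level `3^{k+n+2}` lies in `KS(𝓕_u)`
  [S1a, PROVED] and its bottom class `z^Kato mod 3^{k+n+2}` [BY NAME: `𝔎.bottomClassRed`] has
  `k + 1 ≤ v₃(ord) + i + v₃(#Ш_an)` [⟸ S1b: `ind₃(z_ℚ) ≤ i + v₃(c_ℓ) + v₃(#Ш_an)`, + S1c] — the integral rank-one reciprocity law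
  at a SPLIT multiplicative `3` (`log_E res₃ z^Kato = ℓ₁ · log_E²(P)`, `ℓ₁ = −2ℓ·ord₃(q_E)·(1 − 3⁻¹)`,
  Venerucci 2016 Thm. A (p. 25 of arXiv:1407.1913v2, there `p > 3`); Büyükboduk–Sakamoto–Tsai–Wuthrich 2024
  Thm. 1.13 for `p ∤ N`), read as the EXACT one-place Tamagawa defect `t(z^Kato) = v₃(c_ℓ)`;
then `#Ш[3^∞] ≤ 3^{v₃ #Ш_an}`, i.e. `Typed.MissingUpperBoundAt W 3` (glue `missingUpperBoundAt_three_of_katoRoad`,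
PROVED).  The rest of the crux — the ¬(ram) clause and the (ram) split curves with ≥ 2 carriers off `3`
(Büyükboduk's Question 1 ∕ barrier `StringentKolyvaginCapsAtMax`: Kolyvagin systems see `max`, not `Σ`) — is
the declared residual `stub_offKatoPopulationAtThree` (other lines' populations: inert r9's CoS₃ ∕ saving
display, hybrid's TL₃ + Jetchev-not-ram); the MONO-carrier (ram) curves are PRINT
(`Koly.missingUpperBoundAt_three_of_classX11b_of_ram_of_monoCarrier_of_print`).

References: [MazurRubin2004] Thm. 5.2.12, Prop. 6.2.6, App. A; [Sakamoto2024] Thm. 4.4; [Buyukboduk2009TamagawaDefect]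
Thm. A, Thm. 3.1, §4.2 Q1; [Kato2004Asterisque] Thm. 12.5, §13; Venerucci, arXiv:1407.1913 Thm. A and §6 (ℓ₁, p. 25);
Burungale–Skinner–Tian–Wan, arXiv:2409.01350 Conj. 1.12 ∕ §1.3.3 (Perrin-Riou's conjecture, `≐` up to `ℚˣ`; v2's id
`2211.08762` was WRONG — corrected v3); [Kim2022StructureSelmer] Conj. 1.10.
-/

open scoped Classical NumberField ContRepresentation
open Function Field NumberField IsDedekindDomain Module
open WeierstrassCurve Literature.NumberTheory.EllipticCurves Literature.NumberTheory.GaloisRepresentations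
  Literature.NumberTheory.GaloisRepresentations.DiscreteGaloisModule Literature.NumberTheory.GaloisCohomology
open Literature.NumberTheory.EllipticCurves.Rank1Residual
open Summit.BirchSwinnertonDyer.Rank1Residual Summit.BirchSwinnertonDyer.Rank1Residual.GaloisImage
open Summit.BirchSwinnertonDyer.Rank1Residual.GaloisImage.KSDevissage
open Summit.BirchSwinnertonDyer.Rank1Residual.GaloisImage.TorsionLevel
open Summit.BirchSwinnertonDyer.BirchSwinnertonDyer.Theorems.KimAtThreeD7uTamagawaSharp (pow_mul_dvd_pow_mul_of_le le_add_add_one)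

noncomputable section

namespace Summit.BirchSwinnertonDyer.BirchSwinnertonDyer.Cruxes.EulerHalvesAtThree.KatoDefect

/-! ## §0 The data of the finite-level machinery, bundled ONCE (verbatim the binders of the tree's TOOL
theorem `KimAtThreeD7uTamagawaSharp.exists_isKolyvaginSystem_map_torsionInclusion_eq_add_le`, top level `K`):
a Poitou–Tate invariant family, the bad set `T ⊇ {3} ∪ bad`, no `Γ_ℚ`-fixed torsion, ONE `τ` with
(H.2)-cokernels at every level fixing `μ_{3^{K+1}}`, admissible Kolyvagin data `D i` on every `E[3^i·3]` with ONE
prime set `P ⊆ 𝒫_{τ,3^{K+1}}` off `T`, cyclotomic transverse conditions, THE canonical comparison maps for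
`i ≤ K`, and the level-one prime choice.  Under the `3`-adic tower (a THEOREM on X11b@3 ∧ (ram):
`ExceptionalZeroRoad.Three.towerSurj_of_classX11b_of_ram`) part XXVI (`KimAtThreeD7uTamagawaKuriharaTower`)
CONSTRUCTS such data from Poitou–Tate duality and Tate's local Euler characteristic (`canonicalTowerDataAtThree`, PROVED). -/

/-- The bundled binders of the finite-level Kolyvagin-system machinery for `W` up to level `K`
(module `E[3^K·3]`; see the section docstring). A `structure` of hypotheses; nothing asserted. -/
structure CanonicalTowerData (W : WeierstrassCurve ℚ) [W.IsElliptic]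
    [Finite (geomTorsion W ((3 : ℕ) : ℤ))] [Finite (geomTorsion W (((3 : ℕ) : ℤ) ^ 0 * ((3 : ℕ) : ℤ)))]
    (K : ℕ) where
  inv : LocalInvariants ℚ 3
  hperf : inv.IsPerfect
  hsum : inv.SumLocalTermEqZero
  hcompl : inv.SelmerComplement
  hEP : ∀ v : HeightOneSpectrum (𝓞 ℚ), localEulerPoincareCharacteristic (v.adicCompletion ℚ)
  T : Finset (HeightOneSpectrum (𝓞 ℚ))
  h3T : ∀ v : HeightOneSpectrum (𝓞 ℚ), ((3 : ℕ) : 𝓞 ℚ) ∈ v.asIdeal → v ∈ T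
  hbadT : ∀ v : HeightOneSpectrum (𝓞 ℚ), ¬ W.HasGoodReductionAt v → v ∈ T
  h0 : ∀ (i : ℕ) (P : geomTorsion W (((3 : ℕ) : ℤ) ^ i * ((3 : ℕ) : ℤ))),
    (∀ σ : absoluteGaloisGroup ℚ, W.torsionGaloisModule (((3 : ℕ) : ℤ) ^ i * ((3 : ℕ) : ℤ)) σ P = P) → P = 0
  Sset : Set (HeightOneSpectrum (𝓞 ℚ))
  /-- (v4) `Sset ⊇ {bad places}` — the usability of the class primes for Kato's system (part XXV `hSgood`). -/
  hSgood : ∀ v ∉ Sset, W.HasGoodReductionAt v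
  τ : absoluteGaloisGroup ℚ
  hτ : ∀ i : ℕ, Nonempty (cokerSubOne (W.torsionGaloisModule (((3 : ℕ) : ℤ) ^ i * ((3 : ℕ) : ℤ))) τ ≃+
    ZMod (3 ^ (i + 1)))
  hτ₁ : Nonempty (cokerSubOne (W.torsionGaloisModule ((3 : ℕ) : ℤ)) τ ≃+ ZMod 3)
  hτμ : τ ∈ rootsOfUnityFixer ℚ (3 ^ (K + 1))
  D : (i : ℕ) → KolyvaginDatum (W.torsionGaloisModule (((3 : ℕ) : ℤ) ^ i * ((3 : ℕ) : ℤ)))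
  P : Set (HeightOneSpectrum (𝓞 ℚ))
  hP : ∀ i, (D i).primes = P
  hPT : ∀ q ∈ P, q ∉ T
  hPc : P ⊆ frobeniusClassPrimes (W.torsionGaloisModule (((3 : ℕ) : ℤ) ^ K * ((3 : ℕ) : ℤ))) Sset τ (3 ^ (K + 1))
  hT : ∀ i, (D i).transverse = cyclotomicTransverse _
  η : (q : HeightOneSpectrum (𝓞 ℚ)) → (ZMod (Ideal.absNorm q.asIdeal))ˣ
  hD : ∀ i, i ≤ K → (D i).HasCanonicalComparison (3 ^ (i + 1)) η
  hadm : ∀ i, i ≤ K → (D i).IsAdmissible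
  hprime : ∀ c : galoisCohomology (W.torsionGaloisModule (((3 : ℕ) : ℤ) ^ 0 * ((3 : ℕ) : ℤ))) 1, c ≠ 0 →
    ∀ c' : galoisCohomology (DiscreteGaloisModule.tateDual
      (W.torsionGaloisModule (((3 : ℕ) : ℤ) ^ 0 * ((3 : ℕ) : ℤ))) 3) 1, c' ≠ 0 →
    {q ∈ (D 0).primes |
      galoisCohomology.localization (W.torsionGaloisModule (((3 : ℕ) : ℤ) ^ 0 * ((3 : ℕ) : ℤ)))
        (Sum.inr q) 1 c ≠ 0 ∧
      galoisCohomology.localization (DiscreteGaloisModule.tateDual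
        (W.torsionGaloisModule (((3 : ℕ) : ℤ) ^ 0 * ((3 : ℕ) : ℤ))) 3) (Sum.inr q) 1 c' ≠ 0}.Infinite

/-! **Two inline clauses used below (spelled out at each use; no new `def`s in a crux workfile).**
`LocIdx(W, i)`: `∃ k₀, ∀ k ≥ k₀, #(image of E(ℚ) in E(ℚ₃)/3^{k+1}E(ℚ₃)) = 3^{k+1-i}` — `3^i = [E(ℚ₃)/tors : E(ℚ)]`
for `E(ℚ)` of rank one (Mazur–Rubin's `∂⁰ = i + ∂^∞ + length`), via Mathlib's `Point.map` along `ℚ → ℚ₃`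
(`WeierstrassCurve.toPadicPoint`).  `KatoFrame(W, ℓ, n)`, THE POPULATION OF THE LINE: (ram) X11b@3, `3` split
multiplicative, ONE designated finite `ℓ ∤ 3` with `v₃(c_ℓ) = n + 1` and `3 ∤ c_v` at every other finite `v ∤ 3`
(the two-carrier `{3, ℓ}` frames when `3 ∣ c₃`; `c₃` itself is unconstrained), AND (v3, the critic's P2
ledger, see S1) NO `ℚ₃`-rational `3`-torsion: `E(ℚ₃)[3] = 0` (`f := v₃ #E(ℚ₃)[3^∞] = 0`; for the Tate curve at a
split `3`: `q_E ∉ (ℚ₃ˣ)³`) — the `t = 0` rows of the tree's Kato–Kurihara producer (part XXIV `htop`: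
`𝓕_can,3 = ⊤ ⟺ E(ℚ₃)[3] = 0`).  Frames with `f ≥ 1` go to the residual R. -/

/-! ## §1 The stubs -/

/-- **S0 (PROVED — was the discharge stub of the first draft): canonical tower data EXIST on the population**,
granted Poitou–Tate duality over `ℚ` and Tate's local Euler characteristic (named facts, conjuncts of stub F):
part XXVI `KimAtThreeD7uTamagawaKuriharaTower.exists_pinnedData_of_towerSurj` + `torsion_fixed_eq_zero_of_towerSurj`
under the tower `ExceptionalZeroRoad.Three.towerSurj_of_classX11b_of_ram` (a THEOREM on X11b@3 ∧ (ram)), with a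
generator family `η` from the cyclicity of `(ℤ/q)ˣ`.  [cite: MazurRubin2004, Prop. 3.6.1, Lemma 1.2.3]
[cite: Sakamoto2024, §2, Cor. 5.5] [cite: MilneADT2006, I Thm. 4.10] -/
theorem canonicalTowerDataAtThree
    (hPT : poitouTate_selmerStructure_duality ℚ)
    (hEP : ∀ v : HeightOneSpectrum (𝓞 ℚ), localEulerPoincareCharacteristic (v.adicCompletion ℚ))
    (W : WeierstrassCurve ℚ) [W.IsElliptic] [W.IsGloballyMinimal]
    [Finite (geomTorsion W ((3 : ℕ) : ℤ))] [Finite (geomTorsion W (((3 : ℕ) : ℤ) ^ 0 * ((3 : ℕ) : ℤ)))]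
    (hX : ClassX11b W 3) (hram : Ram W 3) (K : ℕ) : Nonempty (CanonicalTowerData W K) := by
  haveI : Fact (Nat.Prime 3) := ⟨Nat.prime_three⟩
  have htower : ∀ n : ℕ, W.HasSurjectiveModNGaloisRep (3 ^ n : ℕ) :=
    Summit.BirchSwinnertonDyer.BirchSwinnertonDyer.Theorems.ExceptionalZeroRoad.Three.towerSurj_of_classX11b_of_ram
      W hX hram
  obtain ⟨inv, hperf, hsum, -, hcompl⟩ := hPT 3
  have hgen : ∀ q : HeightOneSpectrum (𝓞 ℚ), ∃ η : (ZMod (Ideal.absNorm q.asIdeal))ˣ,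
      Subgroup.zpowers η = ⊤ := fun q => by
    haveI : Fact (Ideal.absNorm q.asIdeal).Prime := ⟨FSComp.prime_absNorm_rat q⟩
    obtain ⟨g, hg⟩ := IsCyclic.exists_generator (α := (ZMod (Ideal.absNorm q.asIdeal))ˣ)
    exact ⟨g, (Subgroup.eq_top_iff' _).mpr hg⟩
  choose η hη using hgen
  obtain ⟨T, τ, D, h3T, hbadT, -, hτq, hτ0, hτμ, hDP, hPT', hDT, hDcan, hadm, hprime⟩ :=
    Summit.BirchSwinnertonDyer.BirchSwinnertonDyer.Theorems.KimAtThreeD7uTamagawaKuriharaTower.exists_pinnedData_of_towerSurj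
      W htower K η hη
  exact ⟨CanonicalTowerData.mk inv hperf hsum hcompl hEP T h3T hbadT
    (Summit.BirchSwinnertonDyer.BirchSwinnertonDyer.Theorems.KimAtThreeD7uTamagawaKuriharaTower.torsion_fixed_eq_zero_of_towerSurj
      W htower)
    (↑T) (fun v hv => by by_contra h; exact hv (Finset.mem_coe.2 (hbadT v h))) τ hτq hτ0 (hτμ (K + 1)) D
    (frobeniusClassPrimes (W.torsionGaloisModule (((3 : ℕ) : ℤ) ^ K * ((3 : ℕ) : ℤ))) ↑T τ (3 ^ (K + 1)))
    hDP hPT' subset_rfl hDT η hDcan hadm hprime⟩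

/-- **stub S2 (L-sized): the finite-level KOLYVAGIN BOUND for `𝓕_can` in analytic rank one, at `3`** —
Sakamoto 2024 Thm. 4.4 (1) `KS(E[3^{k+1}], 𝓕_can) ≅ ℤ/3^{k+1}` and (2) `I(κ^prim_∅) = Fitt⁰ H¹_{𝓕_can^*}` at
`d = ∅` (tree facts `Sakamoto2024.kolyvaginSystems_freeRankOne_zmod_three_pow`,
`…kolyvaginSystems_idealOfBasis_eq_fittingIdeal_zmod_three_pow`; (H.1)–(H.3), (H.SD), cartesian, core rank one,
coisotropy to be DISCHARGED for `T₃E` at a split multiplicative `3` under the tower), PLUS the bookkeeping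
`#H¹_{𝓕_can^*}(ℚ, E[3^{k+1}]) = #Sel_{str at 3} = 3^i · #Ш(E/ℚ)[3^∞]` for `k ≫ 0` (`E(ℚ) ≅ ℤ ⊕ (prime-to-3)` by
GZK on the class, `E(ℚ)[3] = 0` by irreducibility).  Conclusion in the `Typed.missingUpperBoundAt_of_stable`
currency: the local index `i`, a stabilisation level `k'` and `#Ш[3^{k'}] = 3^m`, and for every canonical data
family and every Kolyvagin system `λ` for `𝓕_can` on `E[3^{k+1}]` (`k₀ ≤ k ≤ K`):
`v₃(ord λ_∅) + i + m ≤ k + 1`.  WHY IT MIGHT FAIL: only through a mis-typed bookkeeping identity (the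
mathematics is Sakamoto's theorem + Cassels–Poitou–Tate); the binder discharge at split `3` is real work.
[cite: Sakamoto2024, Thm. 4.4 (p. 927)] [cite: MazurRubin2004, Thm. 5.2.12, Prop. 6.2.6] [cite: MilneADT2006, I §6] -/
theorem stub_kolyvaginBoundCanonicalAtThree
    (hGZK : Literature.NumberTheory.EllipticCurves.rank_eq_analyticRank_of_analyticRank_le_one) :
    ∀ (W : WeierstrassCurve ℚ) [W.IsElliptic] [W.IsGloballyMinimal]
      [Finite (geomTorsion W ((3 : ℕ) : ℤ))] [Finite (geomTorsion W (((3 : ℕ) : ℤ) ^ 0 * ((3 : ℕ) : ℤ)))]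
      (ℓ : HeightOneSpectrum (𝓞 ℚ)) (n : ℕ),
      (ClassX11b W 3 ∧ Ram W 3 ∧ W.HasSplitMultiplicativeReductionAtPrime 3 ∧
        ((3 : ℕ) : 𝓞 ℚ) ∉ ℓ.asIdeal ∧ padicValNat 3 (W.tamagawaNumberAt ℓ) = n + 1 ∧
        ∀ v : HeightOneSpectrum (𝓞 ℚ), ((3 : ℕ) : 𝓞 ℚ) ∉ v.asIdeal → v ≠ ℓ → ¬ 3 ∣ W.tamagawaNumberAt v) →
      ∃ i k' m k₀ : ℕ,
        (∃ k₀ : ℕ, ∀ k : ℕ, k₀ ≤ k →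
          Nat.card ((WeierstrassCurve.toPadicPoint W 3).range.map
            (QuotientAddGroup.mk' (DistribSMul.toAddMonoidHom (W.baseChange ℚ_[3]).toAffine.Point
              ((3 : ℤ) ^ (k + 1))).range)) = 3 ^ (k + 1 - i)) ∧
        (∀ x : W.sha, 3 ^ (k' + 1) • x = 0 → 3 ^ k' • x = 0) ∧
        Nat.card (AddSubgroup.torsionBy W.sha (3 ^ k' : ℕ)) = 3 ^ m ∧
        ∀ (K : ℕ) (𝔇 : CanonicalTowerData W K) (k : ℕ), k₀ ≤ k → k ≤ K →
          ∀ lam : Finset (HeightOneSpectrum (𝓞 ℚ)) →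
              galoisCohomology (W.torsionGaloisModule (((3 : ℕ) : ℤ) ^ k * ((3 : ℕ) : ℤ))) 1,
            (𝔇.D k).IsKolyvaginSystem (propagatedSelmerStructure W 3 k) lam →
            padicValNat 3 (addOrderOf (lam ∅)) + i + m ≤ k + 1 := by
  sorry

/-! ## §1b (v4 — critic V16 STANDING PRICE P1 PAID) KATO'S CLASS **BY NAME**

The v3.1 stub S1 quantified `∃ κ ∈ KS(𝓕_u)` with a bottom-class inequality — output-shaped.  v4 TYPES the
mechanism in three pieces and PROVES the old S1 from them (corollary `katoDerivedClassAtThree`, kernel-checked):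

* the CARRIER `KatoZetaData W` — exactly the binders of the tree's named fact
  `Kato2004.exists_eulerSystem_expStar_values` (Kato 2004 (8.1.3) ∕ Ex. 13.3: ONE newform `f` of `W`, embeddings
  `ι`, the constant `κ ≠ 0`, the dual-exponential datum `Λ`, the guards on `c, d, a, A`, the classes
  `z = (z_{k,r})` on ALL cyclotomic levels `3^k·∏_{q∈r} ℓ_q` and the values `x`, with `hbody : ZetaBody …` = (C1)–(C5));
  it is INHABITED on the Kato population (`nonempty_katoZetaData`, PROVED from the named fact + modularity), so no
  statement below is vacuous by an empty carrier, and no existence is smuggled into the interface;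
* `𝔎.bottomClassRed K` — KATO'S BOTTOM CLASS `z_ℚ := z_{⊥,1} ∈ H¹(ℚ, T₃E)` reduced to `E[3^{K+1}]` (a NAME, an `abbrev`);
* **S1a (PROVED — THEOREM D-u of part XXIII applied to `(C1)+(C2)` of `hbody`):** for every admissible Kolyvagin datum
  `D` on `E[3^K·3]` with cyclotomic transverse condition, THE canonical comparison and level-`K+1` Kolyvagin primes,
  once `3^{K+1} > 2|c||d|A` and `E(ℚ₃)[3] = 0` (so `𝓕_can,3 = ⊤`, [MR04] Lemma A.1 = part XX), Kato's DERIVATIVE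
  classes form a Kolyvagin system `κ ∈ KS(𝓕_u)` — `𝓕_u = 𝓕_BK(⊤ at 3)` — whose bottom class is NAMED:
  `res κ_∅ = Φ (𝔎.bottomClassRed K)`, `Φ` = the change of coefficients `E[3^{K+1}]_{ℤ₃} = E[3^K·3]_ℤ` on `H¹`;
* **S1c (stub, M, folklore):** the finite-level reading of the `3`-DIVISIBILITY INDEX of `z_ℚ`: if `z_ℚ ∉ 3^{m+1}H¹(ℚ,T₃E)`
  and `m ≤ K` then `3^{K+1-m} ∣ ord(κ_∅)` (torsion-freeness of `H¹(ℚ, T₃E)` under `Irr(E[3])`, `H¹(T)/3^{K+1} ↪ H¹(E[3^{K+1}])`,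
  injectivity of `Φ`; [Rubin2000] Lemma 1.2.2 (i)–(ii) ∕ [MazurRubin2004] Lemma 3.5.4-type bookkeeping);
* **S1b (v4 stub; v5 PROVED as `katoIndexBoundAtThree_of_docking` from S1b₀ `stub_katoDockingLawAtThree` — THE BET, the
  bound in the currency of `v₃ log_E(P)` — and S1b₁ `stub_localLogIndexAtThree` — M, local Tate curve):** on a frame `(W, ℓ, n)`
  with `E(ℚ₃)[3] = 0` and local index `i`, SOME Kato datum has `ind₃(z_ℚ) ≤ i + v₃(c_ℓ) + v₃(#Ш_an)` — the integral
  rank-one derived value law at a split multiplicative `3`, in index form (the v3 ledger predicts `=`).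
The only change visible to the glue is the SPELLING of the population clause `E(ℚ₃)[3] = 0`, now in part XXV's
place form `ht0` (every `w ∣ 3`, points over `ℚ_w = w.adicCompletion ℚ`), which is what part XX consumes. -/

section KatoNamed

open scoped TensorProduct
open CategoryTheory CongruenceSubgroup Rat.HeightOneSpectrum
open Literature.NumberTheory.EllipticCurves.ModularForms
open Literature.NumberTheory.EllipticCurves.Kato2004 Literature.NumberTheory.EllipticCurves.Kato2004.EulerSystemValues
open Summit.BirchSwinnertonDyer.Rank1Residual.GaloisImage.TorsionCoeff
open Summit.BirchSwinnertonDyer.BirchSwinnertonDyer.Theorems.KimAtThreeD7uKolyvaginPairBlochKato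

attribute [local instance] TorsionCoeff.torsionBy.padicIntModule

variable (W : WeierstrassCurve ℚ) [W.IsElliptic]
  [ContinuousSMul ℤ_[3] (W.tateModule 3)] [Module.Free ℤ_[3] (W.tateModule 3)]
  [Module.Finite ℤ_[3] (W.tateModule 3)]

/-- **The CARRIER of Kato's Euler system for `W` at `p = 3` (v4, critic P1): the binders of the tree's named fact
`Kato2004.exists_eulerSystem_expStar_values`, bundled.**  `N` the conductor and `f` THE newform of `W`
(`IsNewformOf`, unique by strong multiplicity one), complex embeddings `ι_m` of the `ℚ(ζ_m)`, Kato's constant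
`κ ≠ 0` and dual-exponential value datum `Λ`, the auxiliary integers `c, d, a, A` under Kato's guards
`(c, 6·3·A) = 1`, `(d, 6·3·N) = 1` (Ex. 13.3 p. 225), the classes `z_{k,r} ∈ H¹(ℚ(μ_{3^k ∏ ℓ_q}), T₃W)` on all
cyclotomic levels off `badPlaces c d A N` and the values `x_{k,r}`, with `hbody` = the matrix `ZetaBody` (C1)–(C5).
The structure facts on `T₃W` are instance binders as in the fact.  A structure of data + hypotheses; nothing asserted.
[cite: Kato2004Asterisque, (8.1.3) (p. 180), Ex. 13.3 (pp. 224–225), Thm. 9.7 (p. 189)] -/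
structure KatoZetaData where
  /-- the level of the newform (= the conductor, `hN`) -/
  N : ℕ
  neZero : NeZero N
  hN : N = W.conductorNorm ℤ
  /-- THE newform of `W` -/
  f : CuspForm (Gamma0 N) 2
  hf : haveI := neZero; IsNewformOf W f
  ι : (m : ℕ) → (CyclotomicField m ℚ →+* ℂ)
  /-- Kato's one real constant (P2) -/
  κK : ℝ
  hκK : κK ≠ 0
  Λ : ∀ (k : ℕ) (r : Finset (HeightOneSpectrum (𝓞 ℚ))),
    H1 (tateRep W 3) (cycSubgroup 3 k r) →ₗ[ℤ_[3]] ℚ_[3] ⊗[ℚ] CyclotomicField (cycLevel 3 k r) ℚ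
  c : ℤ
  d : ℤ
  a : ℤ
  A : ℕ
  hA : 0 < A
  hc : Int.gcd c (6 * 3 * A) = 1
  hd : Int.gcd d (6 * 3 * N) = 1
  /-- Kato's classes `z_{k,r}` on all cyclotomic levels `3^k · ∏_{q ∈ r} ℓ_q` off `badPlaces c d A N` -/
  z : ∀ (k : ℕ) (r : (cyclotomicLevelsRat 3 (badPlaces c d A N)).Ideals),
    H1 (tateRep W 3) ((cyclotomicLevelsRat 3 (badPlaces c d A N)).level k r.1)
  x : ∀ (k : ℕ) (r : (cyclotomicLevelsRat 3 (badPlaces c d A N)).Ideals),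
    CyclotomicField (cycLevel 3 k r.1) ℚ
  /-- (C1)–(C5) of Kato (2004) for these witnesses -/
  hbody : ZetaBody W 3 f ι κK Λ c d a A z x

variable {W} in
/-- **KATO'S BOTTOM CLASS, BY NAME:** `z_ℚ := 𝔎.z ⊥ 1 ∈ H¹(ℚ(μ₁) = ℚ, T₃W)` pushed to `E[3^{K+1}]`-coefficients along
the reduction `T₃W ↠ E[3^{K+1}]` (`tateModuleRed`), i.e. `z_ℚ mod 3^{K+1} ∈ H¹(ℚ, E[3^{K+1}]_{ℤ₃})` — the term
THEOREM D-u names as the bottom class of Kato's Kolyvagin system (`hres` at `r = ∅`). -/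
abbrev KatoZetaData.bottomClassRed (𝔎 : KatoZetaData W) (K : ℕ) :
    continuousCohomology 1 (subgroupRep (torsionRepPadicInt W 3 (K + 1)).toTopRep
      ((cyclotomicLevelsRat 3 (badPlaces 𝔎.c 𝔎.d 𝔎.A 𝔎.N)).level ⊥ ∅)) :=
  ContinuousCohomology.map (ContinuousMonoidHom.id _)
    (X := subgroupRep (ContinuousRep.toTopRep (tateRep W 3))
      ((cyclotomicLevelsRat 3 (badPlaces 𝔎.c 𝔎.d 𝔎.A 𝔎.N)).level ⊥ ∅))
    (Y := subgroupRep (ContinuousRep.toTopRep (torsionRepPadicInt W 3 (K + 1)))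
      ((cyclotomicLevelsRat 3 (badPlaces 𝔎.c 𝔎.d 𝔎.A 𝔎.N)).level ⊥ ∅))
    ((TopRep.resFunctor (Subgroup.subtype _)).map
      (tateModuleRed W 3 (W.continuous_galoisRepTate_holds 3) (K + 1))) 1
    (𝔎.z ⊥ (cyclotomicLevelsRat 3 (badPlaces 𝔎.c 𝔎.d 𝔎.A 𝔎.N)).idealOne)

/-- **S0′ (PROVED): the carrier is INHABITED** — from the named fact `Kato2004.exists_eulerSystem_expStar_values`,
modularity `exists_isNewformOf` (both conjuncts of the route's print bundles) and `Irr(E[3])`, with SOME admissible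
auxiliary data (`c = 5`, `d = 1`, `a = 0`, `A = 1`, `ι_m` = a complex embedding of `ℚ(ζ_m)` by algebraic closedness
of `ℂ`).  It only certifies non-vacuity of the interface; S1b asks for a datum with a SMALL index, which this one
need not be.  [cite: Kato2004Asterisque, (8.1.3) (p. 180), Ex. 13.3 (pp. 224–225)] -/
theorem nonempty_katoZetaData (hKato : Kato2004.exists_eulerSystem_expStar_values)
    (hmod : Literature.NumberTheory.EllipticCurves.ModularForms.exists_isNewformOf)
    (hirr : W.HasIrreducibleModPGaloisRep 3) : Nonempty (KatoZetaData W) := by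
  haveI : NeZero (W.conductorNorm ℤ) := ⟨(W.conductorNorm_pos_holds).ne'⟩
  obtain ⟨f, hf⟩ := hmod W
  obtain ⟨κK, hκK, Λ, hz⟩ := hKato W 3 hirr f hf
    (fun m => (IsAlgClosed.lift : CyclotomicField m ℚ →ₐ[ℚ] ℂ).toRingHom)
  have hc5 : Int.gcd 5 (6 * 3 * 1) = 1 := by decide
  have hd1 : Int.gcd 1 (6 * 3 * W.conductorNorm ℤ) = 1 := by simp
  obtain ⟨z, x, hbody⟩ := hz 5 1 0 1 Nat.one_pos hc5 hd1
  exact ⟨⟨W.conductorNorm ℤ, inferInstance, rfl, f, hf, _, κK, hκK, Λ, 5, 1, 0, 1, Nat.one_pos, hc5, hd1,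
    z, x, hbody⟩⟩

variable {W} in
/-- **stub S1c (M, folklore — the finite-level READING of the divisibility index):** if Kato's bottom class
`z_ℚ ∈ H¹(ℚ, T₃W)` is NOT divisible by `3^{m+1}` and `m ≤ K`, then every class `κ₀ ∈ H¹(ℚ, E[3^K·3])` whose
restriction is `Φ(z_ℚ mod 3^{K+1})` has `3^{K+1-m} ∣ ord κ₀`.  Ingredients: `H¹(ℚ, T₃W)` is `ℤ₃`-torsion-free
when `E(ℚ)[3] = 0` (⇐ `Irr(E[3])`; the `H⁰`-term of the `×3` sequence); the kernel of `H¹(ℚ,T) → H¹(ℚ, T/3^{K+1})`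
is `3^{K+1}H¹(ℚ,T)` (long exact sequence of `0 → T → T → E[3^{K+1}] → 0` in continuous cohomology — `E[3^{K+1}]`
discrete, so with continuous sections); `Φ` is injective (the identity on cocycles, every class is a cocycle class:
`oneCocycleClass_surjective`); `ord(f x) ∣ ord x` for the restriction.  WHY IT MIGHT FAIL: only by mis-typing — the
continuous-cohomology long exact sequence for `T₃W` is not yet a tree lemma (Mathlib's `ContinuousCohomology` is
young); mathematically [folklore].  [cite: Rubin2000, Lemma 1.2.2 and Prop. B.2.4] [cite: MazurRubin2004, Lemma 3.5.4]
[cite: NSW2008, (2.7.2)] -/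
theorem stub_katoBottomClassOrderAtThree (𝔎 : KatoZetaData W) (hirr : W.HasIrreducibleModPGaloisRep 3)
    (K m : ℕ) (hm : m ≤ K)
    (hndiv : ∀ y : H1 (tateRep W 3) ((cyclotomicLevelsRat 3 (badPlaces 𝔎.c 𝔎.d 𝔎.A 𝔎.N)).level ⊥ ∅),
      (((3 : ℕ) : ℤ_[3]) ^ (m + 1)) • y ≠
        𝔎.z ⊥ (cyclotomicLevelsRat 3 (badPlaces 𝔎.c 𝔎.d 𝔎.A 𝔎.N)).idealOne)
    (Φ : continuousCohomology 1 (subgroupRep (torsionRepPadicInt W 3 (K + 1)).toTopRep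
            ((cyclotomicLevelsRat 3 (badPlaces 𝔎.c 𝔎.d 𝔎.A 𝔎.N)).level ⊥ ∅)) →+
          continuousCohomology 1 (subgroupRep
            (W.torsionGaloisModule (((3 : ℕ) : ℤ) ^ K * ((3 : ℕ) : ℤ))).toTopRep
            ((cyclotomicLevelsRat 3 (badPlaces 𝔎.c 𝔎.d 𝔎.A 𝔎.N)).level ⊥ ∅)))
    (hΦ : ∀ (φ : contOneCocycles (subgroupRep (torsionRepPadicInt W 3 (K + 1)).toTopRep
            ((cyclotomicLevelsRat 3 (badPlaces 𝔎.c 𝔎.d 𝔎.A 𝔎.N)).level ⊥ ∅)))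
         (ψ : contOneCocycles (subgroupRep
            (W.torsionGaloisModule (((3 : ℕ) : ℤ) ^ K * ((3 : ℕ) : ℤ))).toTopRep
            ((cyclotomicLevelsRat 3 (badPlaces 𝔎.c 𝔎.d 𝔎.A 𝔎.N)).level ⊥ ∅))),
        (∀ g, ψ.1 g = (AddSubgroup.inclusion (geomTorsion_pow_succ_eq W 3 K).le) (φ.1 g)) →
          Φ (oneCocycleClass _ φ) = oneCocycleClass _ ψ)
    (κ₀ : galoisCohomology (W.torsionGaloisModule (((3 : ℕ) : ℤ) ^ K * ((3 : ℕ) : ℤ))) 1)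
    (hname : resSubgroup (W.torsionGaloisModule (((3 : ℕ) : ℤ) ^ K * ((3 : ℕ) : ℤ))).toTopRep
          ((cyclotomicLevelsRat 3 (badPlaces 𝔎.c 𝔎.d 𝔎.A 𝔎.N)).level ⊥ ∅) 1 κ₀ =
        Φ (𝔎.bottomClassRed K)) :
    K + 1 - m ≤ padicValNat 3 (addOrderOf κ₀) := by
  sorry

variable [W.IsGloballyMinimal]

set_option backward.isDefEq.respectTransparency false in
/-- **S1a (PROVED — was the "membership" half of the v3.1 stub S1): Kato's Kolyvagin system for `𝓕_u`, bottom class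
BY NAME.**  For a Kato datum `𝔎`, `Irr(E[3])`, `E(ℚ_w)[3] = 0` at the place `w ∣ 3`, a level `K` with
`2|c||d|A < 3^{K+1}`, and ANY Kolyvagin datum `D` on `E[3^K·3]` with cyclotomic transverse condition, the canonical
comparison at `3^{K+1}` and Kolyvagin primes of level `K + 1`: there are the change-of-coefficients map `Φ` on
`H¹(ℚ, ·)` (`E[3^{K+1}]_{ℤ₃} = E[3^K·3]_ℤ`, characterised on cocycles) and a KOLYVAGIN SYSTEM `κ` for the
unramified ∕ Bloch–Kato structure `𝓕_u = 𝓕_BK(⊤ at 3)` on `E[3^K·3]` with `res κ_∅ = Φ(z_ℚ mod 3^{K+1})`.  Proof: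
THEOREM D-u (`exists_isKolyvaginSystem_pair_blochKatoSelmerStructure_of_unramified_odd`, part XXIII) at one depth,
fed with `(C1) = hbody.1`, `(C2) = hbody.2.1`, the class primes being usable (`≡ 1 mod 3^{K+1}` hence `> 2|c||d|A`,
and `∤ 3N`: part XXV's `husable`), and `𝓕_can,3 = ⊤` from `E(ℚ₃)[3] = 0` (part XX
`propagatedSelmerStructure_three_eq_top_of_torsion_eq_zero`); the naming is D-u's `hres` at `r = ∅`
(`Finset.noncommProd_empty`).  [cite: MazurRubin2004, Thm. 3.2.4 and App. A] [cite: Rubin2000, Ch. 4 §4.4]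
[cite: Kato2004Asterisque, (8.1.3) (p. 180), Prop. 8.12 (p. 186)] -/
theorem katoKolyvaginSystemAtThree_named
    [Finite (geomTorsion W ((3 : ℕ) : ℤ))] [Finite (geomTorsion W (((3 : ℕ) : ℤ) ^ 0 * ((3 : ℕ) : ℤ)))]
    (𝔎 : KatoZetaData W) (hirr : W.HasIrreducibleModPGaloisRep 3)
    (ht0 : ∀ w : HeightOneSpectrum (𝓞 ℚ), ((3 : ℕ) : 𝓞 ℚ) ∈ w.asIdeal →
      ∀ Q : (W.baseChange (w.adicCompletion ℚ)).toAffine.Point, 3 • Q = 0 → Q = 0)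
    (K : ℕ) (hK : 2 * 𝔎.c.natAbs * 𝔎.d.natAbs * 𝔎.A < 3 ^ (K + 1))
    (D : KolyvaginDatum (W.torsionGaloisModule (((3 : ℕ) : ℤ) ^ K * ((3 : ℕ) : ℤ))))
    (hT : D.transverse = cyclotomicTransverse _)
    {η : (q : HeightOneSpectrum (𝓞 ℚ)) → (ZMod (Ideal.absNorm q.asIdeal))ˣ}
    (hD : D.HasCanonicalComparison (3 ^ (K + 1)) η)
    (hKol : ∀ q ∈ D.primes, Kato.IsKolyvaginPrime W 3 (K + 1) ((primesEquiv q : Nat.Primes) : ℕ)) :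
    ∃ (Φ : continuousCohomology 1 (subgroupRep (torsionRepPadicInt W 3 (K + 1)).toTopRep
            ((cyclotomicLevelsRat 3 (badPlaces 𝔎.c 𝔎.d 𝔎.A 𝔎.N)).level ⊥ ∅)) →+
          continuousCohomology 1 (subgroupRep
            (W.torsionGaloisModule (((3 : ℕ) : ℤ) ^ K * ((3 : ℕ) : ℤ))).toTopRep
            ((cyclotomicLevelsRat 3 (badPlaces 𝔎.c 𝔎.d 𝔎.A 𝔎.N)).level ⊥ ∅)))
      (κ : Finset (HeightOneSpectrum (𝓞 ℚ)) →
        galoisCohomology (W.torsionGaloisModule (((3 : ℕ) : ℤ) ^ K * ((3 : ℕ) : ℤ))) 1),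
      (∀ (φ : contOneCocycles (subgroupRep (torsionRepPadicInt W 3 (K + 1)).toTopRep
            ((cyclotomicLevelsRat 3 (badPlaces 𝔎.c 𝔎.d 𝔎.A 𝔎.N)).level ⊥ ∅)))
         (ψ : contOneCocycles (subgroupRep
            (W.torsionGaloisModule (((3 : ℕ) : ℤ) ^ K * ((3 : ℕ) : ℤ))).toTopRep
            ((cyclotomicLevelsRat 3 (badPlaces 𝔎.c 𝔎.d 𝔎.A 𝔎.N)).level ⊥ ∅))),
        (∀ g, ψ.1 g = (AddSubgroup.inclusion (geomTorsion_pow_succ_eq W 3 K).le) (φ.1 g)) →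
          Φ (oneCocycleClass _ φ) = oneCocycleClass _ ψ) ∧
      D.IsKolyvaginSystem (blochKatoSelmerStructure 3 (tateTorsionDatum W 3 K) (fun _ _ => ⊤)) κ ∧
      resSubgroup (W.torsionGaloisModule (((3 : ℕ) : ℤ) ^ K * ((3 : ℕ) : ℤ))).toTopRep
          ((cyclotomicLevelsRat 3 (badPlaces 𝔎.c 𝔎.d 𝔎.A 𝔎.N)).level ⊥ ∅) 1 (κ ∅) =
        Φ (𝔎.bottomClassRed K) := by
  haveI : Fact (Nat.Prime 3) := ⟨Nat.prime_three⟩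
  -- the class primes are usable for Kato's system: `q ≡ 1 mod 3^{K+1}` so `q > 2|c||d|A`, and `q ∤ 3N`
  have hc0 : 𝔎.c ≠ 0 := by
    intro h; have := 𝔎.hc; rw [h] at this; have hA := 𝔎.hA; simp [Int.gcd] at this; omega
  have hd0 : 𝔎.d ≠ 0 := by
    intro h; have := 𝔎.hd; rw [h] at this
    have hN0 : 𝔎.N ≠ 0 := 𝔎.neZero.ne
    simp [Int.gcd] at this; omega
  have hPr : D.primes ⊆ (cyclotomicLevelsRat 3 (badPlaces 𝔎.c 𝔎.d 𝔎.A 𝔎.N)).primes := by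
    intro q hq
    have hq' := hKol q hq
    have hℓ := hq'.prime
    refine (mem_primes_cyclotomicLevelsRat_badPlaces_iff 3 𝔎.c 𝔎.d 𝔎.A 𝔎.N q).2 ⟨fun hdvd => ?_, hq'.ne⟩
    rcases (Nat.Prime.dvd_mul hℓ).mp hdvd with h | h
    · -- `q ∣ 2|c||d|A` is impossible: `q ≡ 1 mod 3^{K+1}`, `q ≠ 1`, so `q > 3^{K+1} > 2|c||d|A > 0`
      have hpos : 0 < 2 * 𝔎.c.natAbs * 𝔎.d.natAbs * 𝔎.A :=
        Nat.mul_pos (Nat.mul_pos (Nat.mul_pos two_pos (Int.natAbs_pos.2 hc0)) (Int.natAbs_pos.2 hd0)) 𝔎.hA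
      have hle : ((primesEquiv q : Nat.Primes) : ℕ) ≤ 2 * 𝔎.c.natAbs * 𝔎.d.natAbs * 𝔎.A :=
        Nat.le_of_dvd hpos h
      have hmod : 3 ^ (K + 1) ≤ ((primesEquiv q : Nat.Primes) : ℕ) := by
        have h1 := hq'.modEq_one
        have hq2 : 2 ≤ ((primesEquiv q : Nat.Primes) : ℕ) := hℓ.two_le
        have h3 : (3 ^ (K + 1) : ℕ) ∣ ((primesEquiv q : Nat.Primes) : ℕ) - 1 :=
          (Nat.modEq_iff_dvd' (by omega)).1 h1.symm
        have h4 : 0 < ((primesEquiv q : Nat.Primes) : ℕ) - 1 := by omega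
        have := Nat.le_of_dvd h4 h3
        omega
      omega
    · apply hq'.not_dvd
      rw [← 𝔎.hN]
      exact dvd_mul_of_dvd_left h 3
  -- `𝓕_can,3 = ⊤` at every depth from `E(ℚ₃)[3] = 0` (part XX, [MR04] Lemma A.1)
  have htw : ∀ j : ℕ,
      ∃ redj : (W.torsionGaloisModule (((3 : ℕ) : ℤ) ^ (j + 1) * ((3 : ℕ) : ℤ))).toContRepresentation →ⁱL
          (W.torsionGaloisModule (((3 : ℕ) : ℤ) ^ j * ((3 : ℕ) : ℤ))).toContRepresentation,
        ∀ y : geomTorsion W (((3 : ℕ) : ℤ) ^ (j + 1) * ((3 : ℕ) : ℤ)),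
          ((redj y : geomTorsion W (((3 : ℕ) : ℤ) ^ j * ((3 : ℕ) : ℤ))) : geomPoints W) =
            ((3 : ℕ) : ℤ) • (y : geomPoints W) := by
    intro j
    obtain ⟨redj, hredj⟩ := exists_torsionReduction_three W j (j + 1)
    refine ⟨redj, fun y => ?_⟩
    rw [hredj, Nat.add_sub_cancel_left, pow_one]
  choose redT hredT using htw
  have htop : ∀ w : HeightOneSpectrum (𝓞 ℚ), ((primesEquiv w : Nat.Primes) : ℕ) = 3 →
      propagatedSelmerStructure W 3 K (Sum.inr w) = ⊤ := by
    intro w hw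
    have hw3 : ((3 : ℕ) : 𝓞 ℚ) ∈ w.asIdeal := KolyvaginPrime.natCast_mem_asIdeal_of_primesEquiv_eq hw
    exact propagatedSelmerStructure_three_eq_top_of_torsion_eq_zero W w hw3 (ht0 w hw3) redT hredT K
  -- the reduction `T₃E ↠ E[3^{K+1}]` is onto; the pinned reduction at one depth
  have hred : Function.Surjective
      (tateModuleRed W 3 (W.continuous_galoisRepTate_holds 3) (K + 1)).hom := by
    intro y
    obtain ⟨b, hb⟩ := W.proj_surjective_of_isAlgClosed_holds 3 (K + 1) y.2
    exact ⟨b, Subtype.ext hb⟩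
  obtain ⟨π, hπ⟩ := exists_torsionReduction_three W K K
  -- THEOREM D-u for Kato's system `𝔎.z` ((C1) = `hbody.1`, (C2) = `hbody.2.1`), one depth (twice)
  obtain ⟨σ, Φ, comm, κf, Φ'', comm'', κu, hσI, hσχ, hΦ, hΦ'', hKS, hKS'', -, -, hres, hres'', hcomp⟩ :=
    exists_isKolyvaginSystem_pair_blochKatoSelmerStructure_of_unramified_odd W 3
      (badPlaces 𝔎.c 𝔎.d 𝔎.A 𝔎.N) (by decide) (le_refl K) 𝔎.hbody.1
      (tateModuleRed W 3 (W.continuous_galoisRepTate_holds 3) (K + 1)) hred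
      (fun y => pow_smul_eq_zero 3 (K + 1) _ y)
      (AddSubgroup.inclusion (geomTorsion_pow_succ_eq W 3 K).le : _ →+ _) continuous_of_discreteTopology
      (fun _ _ => rfl)
      (AddSubgroup.inclusion (geomTorsion_pow_succ_eq W 3 K).ge : _ →+ _) continuous_of_discreteTopology
      (fun y => Subtype.ext rfl) (fun y => Subtype.ext rfl) (fun _ => rfl)
      (tateModuleRed W 3 (W.continuous_galoisRepTate_holds 3) (K + 1)) hred
      (fun y => pow_smul_eq_zero 3 (K + 1) _ y)
      (AddSubgroup.inclusion (geomTorsion_pow_succ_eq W 3 K).le : _ →+ _) continuous_of_discreteTopology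
      (fun _ _ => rfl)
      (AddSubgroup.inclusion (geomTorsion_pow_succ_eq W 3 K).ge : _ →+ _) continuous_of_discreteTopology
      (fun y => Subtype.ext rfl) (fun y => Subtype.ext rfl) (fun _ => rfl)
      π hπ hirr D hT D hT hD hD hPr hPr hKol hKol 𝔎.hbody.2.1 htop htop
  refine ⟨Φ ∅, κf, fun φ ψ h => hΦ ∅ φ ψ h, hKS, ?_⟩
  have h := hres ∅ (by simp)
  rw [Finset.noncommProd_empty] at h
  rw [h]
  rfl

/-- **stub S1b₀ — THE BET (XL, hardest; v5 = critic V22 P2⁗ «docking display»): the KATO INDEX BOUND IN LOGARITHMIC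
CURRENCY at a split multiplicative `3` in analytic rank one.**  On a frame `(W, ℓ, n)` (X11b@3, (ram), `3` SPLIT, ONE
Tamagawa-`3` carrier `ℓ ∤ 3` with `v₃(c_ℓ) = n + 1`) with `#Ш_an = q`, for the place `w ∣ 3` and ANY rational point `P` of
infinite order: ONE Kato datum `𝔎` — chosen BEFORE `w` and `P` (v5.1, critic V27 P1: Kato's datum depends on `(c, d, a, A)` and the
newform only, never on `P`; `∃ 𝔎, ∀ w P` is the law the card's rows R1–R8 derive) — has bottom class `z_ℚ = 𝔎.z ⊥ 1 ∈ H¹(ℚ, T₃E)`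
of `3`-divisibility index `ind₃(z_ℚ) ≤ v₃(q) + v₃(c_ℓ) + v₃(c₃) − 1 + v₃ log_E(P)`, where `v₃ log_E(P)` is the tree's `padicLogOrd W 3 ι P`
(formal-group logarithm for the Néron differential, extended `ℤ₃`-linearly: `= log(m₀P)/m₀`, which on the Tate curve IS
Venerucci's branch `log_{q_E} ∘ Φ_Tate⁻¹`).  No local index `i`, no `E(ℚ₃)[3] = 0` clause: those live in S1b₁.  WHAT IT
ENCODES (card `Lines/katodefect.md` §v5, rows R1–R8): by the frame lemma G (`H¹(G_S, T₃E) = ℤ₃·κ(P₀)` in rank one off torsion)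
every `S`-unramified class is `λ·κ(P₀)` with `ind₃ = v₃ λ`; for the Néron-normalised Beilinson–Kato class Venerucci's Thm A
(`log_E res₃ ζ^BK = ℓ₁ log_E(𝐏)²`, in print for `p > 3`) + the BD07 normalisation of `(ℓ, 𝐏)` + explicit Gross–Zagier on
`X_{N⁺,3ℓ₀}` + Takahashi 2001 Cor. 2.6 (`deg_Sh = h₃/c₃`) + the DEFINITION of `#Ш_an` give
`v₃ λ(ζ^BK) = v₃(q) + (n+1) + v₃(c₃) − 1 + v₃ log_E(P₀) + v₃(κ_BD)` (`c₃` cancels twice); a Kato datum differs from `ζ^BK` by the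
Manin-type period unit `ϖ` (`v₃ = 0` at `3 ∥ N`, Mazur 1978 + `Irr(E[3])`) and the modular-symbol scalar `t(c,d,a,A)`; so S1b₀ ⟸
conj@3 (Thm A at `3`: bsd-stepL/mult-p4 audit, memo-closed) ∧ `v₃ κ_BD = 0` ((A5), open bookkeeping at EVERY `p`) ∧ U3′ ∧ U0@3
(the admissible `a(A)`-type plus classes span `V_{ℤ₃}(f)⁺ mod 3` — elementary, per-frame decidable).  For a non-generator
`P = kP₀ + T` the bound only weakens by `v₃(k)`.  WHY IT MIGHT FAIL: (a) `v₃(κ_BD) > 0` or a 3-adically non-trivial pairing-weight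
convention in `η_f` (U2′); (b) U0@3 false on some frame (all admissible `t` divisible by `3`) — the line's private kill switch;
(c) conj@3 (referee pending).  LABEL (V22 P1⁗): literature-gap bet of AUDIT grade — NO PROVER SEAT.
[cite: Kato2004Asterisque, Thm. 12.5, §13.9–13.12] Venerucci arXiv:1407.1913 Thm. A, Rem. 2.2, §6.1; Takahashi, JNT 90 (2001) Thm. 2.3–2.4,
Cor. 2.6; Cai–Shu–Tian, ANT 8 (2014) Thm. 1.5; [cite: MazurRubin2004, Thm. 5.2.12]; Burungale–Skinner–Tian–Wan arXiv:2409.01350 Conj. 1.12 -/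
theorem stub_katoDockingLawAtThree :
    ∀ (W : WeierstrassCurve ℚ) [W.IsElliptic] [W.IsGloballyMinimal]
      [ContinuousSMul ℤ_[3] (W.tateModule 3)] [Module.Free ℤ_[3] (W.tateModule 3)]
      [Module.Finite ℤ_[3] (W.tateModule 3)]
      (ℓ : HeightOneSpectrum (𝓞 ℚ)) (n : ℕ),
      (ClassX11b W 3 ∧ Ram W 3 ∧ W.HasSplitMultiplicativeReductionAtPrime 3 ∧
        ((3 : ℕ) : 𝓞 ℚ) ∉ ℓ.asIdeal ∧ padicValNat 3 (W.tamagawaNumberAt ℓ) = n + 1 ∧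
        ∀ v : HeightOneSpectrum (𝓞 ℚ), ((3 : ℕ) : 𝓞 ℚ) ∉ v.asIdeal → v ≠ ℓ → ¬ 3 ∣ W.tamagawaNumberAt v) →
      ∀ q : ℚ, shaAn W = (q : ℂ) →
      ∃ 𝔎 : KatoZetaData W,
        ∀ w : HeightOneSpectrum (𝓞 ℚ), ((3 : ℕ) : 𝓞 ℚ) ∈ w.asIdeal →
        ∀ P : (W.baseChange ℚ).toAffine.Point, ¬ IsOfFinAddOrder P →
        ∀ (m : ℕ) (y : H1 (tateRep W 3) ((cyclotomicLevelsRat 3 (badPlaces 𝔎.c 𝔎.d 𝔎.A 𝔎.N)).level ⊥ ∅)),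
          (((3 : ℕ) : ℤ_[3]) ^ m) • y = 𝔎.z ⊥ (cyclotomicLevelsRat 3 (badPlaces 𝔎.c 𝔎.d 𝔎.A 𝔎.N)).idealOne →
            (m : ℤ) ≤ padicValRat 3 q + (n + 1) + padicValNat 3 (W.tamagawaNumberAt w) - 1 +
              Literature.NumberTheory.EllipticCurves.padicLogOrd W 3 (algebraMap ℚ ℚ_[3]) P := by
  sorry

/-- **stub S1b₁ (M, local — the Tate curve at a split `3`; v5):** `v₃ log_E` OF A BEST RATIONAL POINT EQUALS THE LOCAL INDEX,
SHIFTED.  If `3` is split multiplicative, `E(ℚ_w)[3] = 0` (`w ∣ 3`) and the image of `E(ℚ)` in `E(ℚ₃)/3^{k+1}` has order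
`3^{k+1−i}` for `k ≫ 0`, then there are a place `w ∣ 3` and a rational point `P` of infinite order with
`v₃ log_E(P) = i + 1 − v₃(c₃)` (`c₃ = c_w`).  PROOF ON PAPER (card §v5 R2 = v3 ledger L4): `E(ℚ₃) = ℚ₃ˣ/q^ℤ`, `s := v₃(c₃) =
v₃ ord₃(q)`, `e := v₃ log₃(q′) ≥ 1` (`q′` the unit part); `E(ℚ₃)[3] ≠ 0 ⟺ s ≥ 1 ∧ e ≥ 2`, so here `f := min(s, e−1) = 0` and
`E(ℚ₃) ⊗ ℤ₃ ≅ ℤ₃γ₀` with `v₃ log_E(γ₀) = min(1, e − s)` (`log_E = log_{q} ∘ Φ⁻¹`, `log_q(3) = −log₃(q′)/ord₃(q)` of valuation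
`e − s`, units give `3ℤ₃`); the image of `E(ℚ) = ℤP₀ ⊕ T` (`#T` prime to `3`) is generated by `P₀ = 3^{i}u·γ₀`, whence the `i` of the
hypothesis, and `v₃ log_E(P₀) = i + min(1, e−s) = i + 1 − s` in both cases (`s = 0 ⇒ min(1,e) = 1`; `s ≥ 1 ⇒ e = 1`).  `padicLogOrd`
is that valuation (`log(m₀P)/m₀`, `m₀ = [E(ℚ₃):E₁(ℚ₃)] = 2c₃`, formal log of the minimal model = `log₃` on `1 + 3ℤ₃` up to a unit).
Rank `0` makes the index hypothesis unsatisfiable (vacuous); rank `≥ 2` is not excluded and harmless (take `P` of minimal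
coefficient valuation).  A place `w ∣ 3` of `𝓞 ℚ` exists.  Size M: Tate uniformisation bookkeeping over `padicLogPoint`/`formalIndex`.
[cite: SilvermanAEC2009, IV.6.4, VII.2.2, C.14] [cite: SilvermanAdvancedTopics1994, V.3, V.5] -/
theorem stub_localLogIndexAtThree :
    ∀ (W : WeierstrassCurve ℚ) [W.IsElliptic] [W.IsGloballyMinimal],
      W.HasSplitMultiplicativeReductionAtPrime 3 →
      (∀ w : HeightOneSpectrum (𝓞 ℚ), ((3 : ℕ) : 𝓞 ℚ) ∈ w.asIdeal →
        ∀ Q : (W.baseChange (w.adicCompletion ℚ)).toAffine.Point, 3 • Q = 0 → Q = 0) →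
      ∀ i : ℕ, (∃ k₀ : ℕ, ∀ k : ℕ, k₀ ≤ k →
        Nat.card ((WeierstrassCurve.toPadicPoint W 3).range.map
          (QuotientAddGroup.mk' (DistribSMul.toAddMonoidHom (W.baseChange ℚ_[3]).toAffine.Point
            ((3 : ℤ) ^ (k + 1))).range)) = 3 ^ (k + 1 - i)) →
      ∃ (w : HeightOneSpectrum (𝓞 ℚ)) (P : (W.baseChange ℚ).toAffine.Point),
        ((3 : ℕ) : 𝓞 ℚ) ∈ w.asIdeal ∧ ¬ IsOfFinAddOrder P ∧
          Literature.NumberTheory.EllipticCurves.padicLogOrd W 3 (algebraMap ℚ ℚ_[3]) P =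
            (i : ℤ) + 1 - padicValNat 3 (W.tamagawaNumberAt w) := by
  sorry

/-- **S1b (v4's bet; v5: PROVED from S1b₀ + S1b₁ by arithmetic — `v₃q + (n+1) + s − 1 + (i + 1 − s) = i + (n+1) + v₃q`): the KATO
DIVISIBILITY INDEX BOUND at a split multiplicative `3` in analytic rank one.**
On a frame `(W, ℓ, n)` of the Kato population (X11b@3, (ram), `3` SPLIT, ONE Tamagawa-`3` carrier `ℓ ∤ 3` with
`v₃(c_ℓ) = n + 1`, `E(ℚ₃)[3] = 0`) with local index `i` (`#E(ℚ₃)/3^{k+1} ⊇ E(ℚ)` of index `3^{k+1-i}`, `k ≫ 0`) and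
`#Ш_an = q`: SOME Kato datum `𝔎` (a choice of `c, d, a, A` — and, implicitly, Kato's genuine classes rather than a
degenerate witness of the fact) has bottom class `z_ℚ = 𝔎.z ⊥ 1 ∈ H¹(ℚ, T₃E)` of `3`-DIVISIBILITY INDEX
`ind₃(z_ℚ) := max{m : z_ℚ ∈ 3^m H¹} ≤ i + v₃(c_ℓ) + v₃(q)`.  In print this is the INTEGRAL rank-one reciprocity
("derived value") law `log_E res₃ z^Kato = C · log_E(P)²` with `v₃(C)` pinned: the v3 PAPER LEDGER (docstring of the
corollary below; BSD(E), BSD(E^K), GZ–Zhang on `X_{N⁺,3N⁻}`, Ribet–Takahashi, Pollack–Weston) predicts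
`ind₃(z^Kato) = i + f + v₃(c_ℓ) + v₃ #Ш` with `f = v₃ #E(ℚ₃)[3^∞] = 0` HERE — so the bound is predicted SHARP-TRUE and
is, given S2 ∕ S3 ∕ S1c, the `p = 3` split-multiplicative case of Perrin-Riou's ∕ Kato's divisibility being OPTIMAL at
the bottom layer (⟸ BSD₃ direction `#Ш[3^∞] ≤ 3^{v₃ #Ш_an}` on this population; NOT ⟺ BSD: no statement about other
primes, other populations, or the Selmer side).  WHY IT MIGHT FAIL: (a) the law is in print only for `p > 3` split
(Venerucci 2016 Thm. A) ∕ `p ∤ N` (Burungale–Skinner–Tian–Wan 2024, `≐` up to `ℚˣ` — valuation-empty); (b) a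
`3`-adic failure of one of the four `≐` normalisations of the ledger at a split `3` (Gross period ∕ JL on `X_{N⁺,3N⁻}`,
Manin constant at `3 ∣ N`); (c) Kato's integrality at `p = 3 ∣ N` with only `Irr(E[3])` (Thm. 12.5 (4) wants more
image) — an extra `3`-power in `z_ℚ` would make the index LARGER (fatal) — and the auxiliary factors
`(c² − c·1)(d² − d·1)`-type at the bottom level must be `3`-units for the chosen `c, d` (choose `c ≡ d ≡ 2 mod 3`);
(d) `q = #Ш_an` enters only through `v₃`, so a non-integral `#Ш_an` at `3` is not excluded here but by S2's side.
[cite: Kato2004Asterisque, Thm. 12.5, §13.9–13.12] [cite: MazurRubin2004, Thm. 5.2.12] Venerucci, arXiv:1407.1913 Thm. A,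
§6; Burungale–Skinner–Tian–Wan, arXiv:2409.01350 Conj. 1.12 ∕ §1.3.3; [cite: Buyukboduk2009TamagawaDefect, Thm. A];
[cite: PerrinRiou1993, Conj. 3.3.7 (B)] -/
theorem katoIndexBoundAtThree_of_docking :
    ∀ (W : WeierstrassCurve ℚ) [W.IsElliptic] [W.IsGloballyMinimal]
      [ContinuousSMul ℤ_[3] (W.tateModule 3)] [Module.Free ℤ_[3] (W.tateModule 3)]
      [Module.Finite ℤ_[3] (W.tateModule 3)]
      (ℓ : HeightOneSpectrum (𝓞 ℚ)) (n : ℕ),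
      (ClassX11b W 3 ∧ Ram W 3 ∧ W.HasSplitMultiplicativeReductionAtPrime 3 ∧
        ((3 : ℕ) : 𝓞 ℚ) ∉ ℓ.asIdeal ∧ padicValNat 3 (W.tamagawaNumberAt ℓ) = n + 1 ∧
        ∀ v : HeightOneSpectrum (𝓞 ℚ), ((3 : ℕ) : 𝓞 ℚ) ∉ v.asIdeal → v ≠ ℓ → ¬ 3 ∣ W.tamagawaNumberAt v) →
      (∀ w : HeightOneSpectrum (𝓞 ℚ), ((3 : ℕ) : 𝓞 ℚ) ∈ w.asIdeal →
        ∀ Q : (W.baseChange (w.adicCompletion ℚ)).toAffine.Point, 3 • Q = 0 → Q = 0) →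
      ∀ i : ℕ, (∃ k₀ : ℕ, ∀ k : ℕ, k₀ ≤ k →
        Nat.card ((WeierstrassCurve.toPadicPoint W 3).range.map
          (QuotientAddGroup.mk' (DistribSMul.toAddMonoidHom (W.baseChange ℚ_[3]).toAffine.Point
            ((3 : ℤ) ^ (k + 1))).range)) = 3 ^ (k + 1 - i)) →
      ∀ q : ℚ, shaAn W = (q : ℂ) →
      ∃ 𝔎 : KatoZetaData W,
        ∀ (m : ℕ) (y : H1 (tateRep W 3) ((cyclotomicLevelsRat 3 (badPlaces 𝔎.c 𝔎.d 𝔎.A 𝔎.N)).level ⊥ ∅)),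
          (((3 : ℕ) : ℤ_[3]) ^ m) • y = 𝔎.z ⊥ (cyclotomicLevelsRat 3 (badPlaces 𝔎.c 𝔎.d 𝔎.A 𝔎.N)).idealOne →
            (m : ℤ) ≤ i + (n + 1) + padicValRat 3 q := by
  intro W _ _ _ _ _ ℓ n hF ht0 i hidx q hq
  obtain ⟨w, P, hw, hP, hlog⟩ := stub_localLogIndexAtThree W hF.2.2.1 ht0 i hidx
  obtain ⟨𝔎, h𝔎⟩ := stub_katoDockingLawAtThree W ℓ n hF q hq
  refine ⟨𝔎, fun m y hy => ?_⟩
  have h := h𝔎 w hw P hP m y hy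
  rw [hlog] at h
  linarith

/-- **COROLLARY (PROVED; v3.1's stub S1, VERBATIM up to the spelling of `E(ℚ₃)[3] = 0`) — Kato's Kolyvagin system
with controlled bottom class, from S1b (the bet) + S1a (THEOREM D-u) + S1c (reading).**  For a frame `(W, ℓ, n)` with
`E(ℚ₃)[3] = 0` and local index `i`: for `k ≫ 0` and every canonical data family at level `k + n + 1` there is a
Kolyvagin system `κ` for `𝓕_u` on `E[3^{k+n+2}]` with `k + 1 ≤ v₃(ord κ_∅) + i + v₃(#Ш_an)`.  Arithmetic: S1b at
`m = 0` gives `B := i + (n+1) + v₃ q ≥ 0`; take `k₁ := B + |2cdA|`; at level `K = k + n + 1 ≥ B` the class `z_ℚ` is not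
divisible by `3^{B+1}` (S1b), so S1c with `m = B` gives `v₃ ord κ_∅ ≥ K + 1 − B = k + 1 − i − v₃ q`.
**v3 — THE PAPER v₃-LEDGER (critic V11-P2), kept for the record** (heuristic under BSD(E), BSD(E^K), GZ–Zhang on
`X_{N⁺,3N⁻}` with Ribet–Takahashi `δ_N/δ_{N⁺,3N⁻} = ∏_{q∣3N⁻} c_q(E)`, Pollack–Weston `η_N/η_f = ∏_{q∣N⁻} c_q(E)`,
`Ω_A⁺ = Ω_E⁺`, `E[3]` irreducible, `2`-powers ∕ Manin ignored): with `z^Kato = λ·𝐏`, `λ = ℓ₁·log_A 𝐏`, `𝐏 ≐ y_K = β·P`: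
`v₃(ℓ) + 2v₃(β) = v₃#Ш(E) + Σ_{q∤3} v₃c_q(E) = v₃#Ш + v₃(c_ℓ)` — `K`-INDEPENDENT and `c₃`-FREE; locally (Tate curve,
`s := v₃ c₃`, `e := v₃ log₃ q_E ≥ 1`) `E(ℚ₃)⊗ℤ₃ ≅ ℤ₃γ ⊕ ℤ/3^f`, `f = min(s, e−1)`, `v₃ log_A P = i + min(1, e−s)`, whence
`ind₃(z^Kato) = v₃#Ш + v₃(c_ℓ) + i + f`: on MONO-carrier frames (`f = 0`) the print equality; on two-carrier frames with
`f = 0` SHARP-TRUE ⟺ BSD₃; with `f ≥ 1` FALSE by exactly `f` — whence the population clause `E(ℚ₃)[3] = 0` (`f ≥ 1`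
frames live in the residual R).  [cite: Kato2004Asterisque, Thm. 12.5, §13] [cite: MazurRubin2004, Thm. 5.2.12, App. A]
Venerucci arXiv:1407.1913 Thm. A; Burungale–Skinner–Tian–Wan arXiv:2409.01350 Conj. 1.12; [cite: Buyukboduk2009TamagawaDefect, Thm. A] -/
theorem katoDerivedClassAtThree :
    ∀ (W : WeierstrassCurve ℚ) [W.IsElliptic] [W.IsGloballyMinimal]
      [Finite (geomTorsion W ((3 : ℕ) : ℤ))] [Finite (geomTorsion W (((3 : ℕ) : ℤ) ^ 0 * ((3 : ℕ) : ℤ)))]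
      (ℓ : HeightOneSpectrum (𝓞 ℚ)) (n : ℕ),
      (ClassX11b W 3 ∧ Ram W 3 ∧ W.HasSplitMultiplicativeReductionAtPrime 3 ∧
        ((3 : ℕ) : 𝓞 ℚ) ∉ ℓ.asIdeal ∧ padicValNat 3 (W.tamagawaNumberAt ℓ) = n + 1 ∧
        ∀ v : HeightOneSpectrum (𝓞 ℚ), ((3 : ℕ) : 𝓞 ℚ) ∉ v.asIdeal → v ≠ ℓ → ¬ 3 ∣ W.tamagawaNumberAt v) →
      (∀ w : HeightOneSpectrum (𝓞 ℚ), ((3 : ℕ) : 𝓞 ℚ) ∈ w.asIdeal →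
        ∀ Q : (W.baseChange (w.adicCompletion ℚ)).toAffine.Point, 3 • Q = 0 → Q = 0) →
      ∀ i : ℕ, (∃ k₀ : ℕ, ∀ k : ℕ, k₀ ≤ k →
        Nat.card ((WeierstrassCurve.toPadicPoint W 3).range.map
          (QuotientAddGroup.mk' (DistribSMul.toAddMonoidHom (W.baseChange ℚ_[3]).toAffine.Point
            ((3 : ℤ) ^ (k + 1))).range)) = 3 ^ (k + 1 - i)) →
      ∀ q : ℚ, shaAn W = (q : ℂ) →
      ∃ k₁ : ℕ, ∀ k : ℕ, k₁ ≤ k → ∀ 𝔇 : CanonicalTowerData W (k + n + 1),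
        ∃ κ : Finset (HeightOneSpectrum (𝓞 ℚ)) →
            galoisCohomology (W.torsionGaloisModule (((3 : ℕ) : ℤ) ^ (k + n + 1) * ((3 : ℕ) : ℤ))) 1,
          (𝔇.D (k + n + 1)).IsKolyvaginSystem
            (blochKatoSelmerStructure 3 (tateTorsionDatum W 3 (k + n + 1)) (fun _ _ => ⊤)) κ ∧
          ((k + 1 : ℕ) : ℤ) ≤ (padicValNat 3 (addOrderOf (κ ∅)) : ℤ) + i + padicValRat 3 q := by
  intro W _ _ _ _ ℓ n hF ht0 i hidx q hq
  haveI : Fact (Nat.Prime 3) := ⟨Nat.prime_three⟩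
  haveI : ContinuousSMul ℤ_[3] (W.tateModule 3) := TateModule.continuousSMul_padicInt
  haveI : Module.Free ℤ_[3] (W.tateModule 3) := W.module_free_tateModule_holds 3
  haveI : Module.Finite ℤ_[3] (W.tateModule 3) := W.module_finite_tateModule_holds 3
  have htower : ∀ m : ℕ, W.HasSurjectiveModNGaloisRep (3 ^ m : ℕ) :=
    Summit.BirchSwinnertonDyer.BirchSwinnertonDyer.Theorems.ExceptionalZeroRoad.Three.towerSurj_of_classX11b_of_ram
      W hF.1 hF.2.1
  haveI : NeZero ((3 : ℕ) : ℚ) := ⟨by norm_num⟩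
  have hsurj : W.HasSurjectiveModNGaloisRep ((3 : ℕ) : ℤ) := by simpa using htower 1
  have hirr : W.HasIrreducibleModPGaloisRep 3 :=
    hasIrreducibleModPGaloisRep_of_hasSurjectiveModNGaloisRep W 3 hsurj
  -- S1b: a Kato datum with SMALL divisibility index `≤ B`
  obtain ⟨𝔎, hind⟩ := katoIndexBoundAtThree_of_docking W ℓ n hF ht0 i hidx q hq
  have hB0 : (0 : ℤ) ≤ i + (n + 1) + padicValRat 3 q := by
    have h := hind 0 (𝔎.z ⊥ (cyclotomicLevelsRat 3 (badPlaces 𝔎.c 𝔎.d 𝔎.A 𝔎.N)).idealOne)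
      (by rw [pow_zero, one_smul])
    simpa using h
  set B : ℕ := (i + (n + 1) + padicValRat 3 q).toNat with hBdef
  have hB : (B : ℤ) = i + (n + 1) + padicValRat 3 q := by rw [hBdef]; exact Int.toNat_of_nonneg hB0
  refine ⟨B + 2 * 𝔎.c.natAbs * 𝔎.d.natAbs * 𝔎.A, fun k hk 𝔇 => ?_⟩
  -- the guard `2|c||d|A < 3^{K+1}`, `K = k + n + 1`
  have hK : 2 * 𝔎.c.natAbs * 𝔎.d.natAbs * 𝔎.A < 3 ^ (k + n + 1 + 1) :=
    lt_of_le_of_lt (le_trans (Nat.le_add_left _ _) hk)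
      (lt_of_lt_of_le (Nat.lt_pow_self (by norm_num : 1 < 3)) (Nat.pow_le_pow_right (by norm_num) (by omega)))
  -- S1a: Kato's Kolyvagin system for `𝓕_u` on `E[3^K·3]` for the data `𝔇.D K`, bottom class named
  have hKol : ∀ v ∈ (𝔇.D (k + n + 1)).primes,
      Kato.IsKolyvaginPrime W 3 (k + n + 1 + 1) ((primesEquiv v : Nat.Primes) : ℕ) := by
    intro v hv
    rw [𝔇.hP (k + n + 1)] at hv
    exact KolyvaginPrime.isKolyvaginPrime_of_mem_frobeniusClassPrimes_of_le W le_rfl 𝔇.hSgood 𝔇.hτμ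
      (𝔇.hτ (k + n + 1)) (𝔇.hPc hv)
  obtain ⟨Φ, κ, hΦ, hKS, hname⟩ := katoKolyvaginSystemAtThree_named W 𝔎 hirr ht0 (k + n + 1) hK
    (𝔇.D (k + n + 1)) (𝔇.hT (k + n + 1)) (𝔇.hD (k + n + 1) le_rfl) hKol
  refine ⟨κ, hKS, ?_⟩
  -- S1c at `m = B ≤ K`: `z_ℚ ∉ 3^{B+1} H¹` by S1b
  have hndiv : ∀ y : H1 (tateRep W 3) ((cyclotomicLevelsRat 3 (badPlaces 𝔎.c 𝔎.d 𝔎.A 𝔎.N)).level ⊥ ∅),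
      (((3 : ℕ) : ℤ_[3]) ^ (B + 1)) • y ≠
        𝔎.z ⊥ (cyclotomicLevelsRat 3 (badPlaces 𝔎.c 𝔎.d 𝔎.A 𝔎.N)).idealOne := by
    intro y hy
    have h := hind (B + 1) y hy
    push_cast at h
    omega
  have hS1c := stub_katoBottomClassOrderAtThree 𝔎 hirr (k + n + 1) B (by omega) hndiv Φ hΦ (κ ∅) hname
  have hcast : ((k + n + 1 + 1 - B : ℕ) : ℤ) = (k + n + 1 + 1 : ℕ) - (B : ℤ) := by
    rw [Nat.cast_sub (by omega)]
  have h1 : ((k + n + 1 + 1 - B : ℕ) : ℤ) ≤ (padicValNat 3 (addOrderOf (κ ∅)) : ℤ) := by exact_mod_cast hS1c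
  rw [hcast] at h1
  push_cast at h1 ⊢
  linarith

end KatoNamed

/-- **stub R (declared RESIDUAL — NOT this line's lever; its second disjunct is OPEN, NO LINE — NOT COVERED by
this or any registered line: a lead must not read it as handled): the crux OFF the Kato population.**  Verbatim
`Typed.MissingUpperBoundAt W 3` on (i) the ¬(ram) ∧ surj clause (3) of the crux (no transvection `τ` from
geometry: hybrid's TL₃ + Jetchev-not-ram, exz's clause-3 theorem, bsd-idea-4's base-change LINE 8 on 19064@3), and
(ii) the (ram) curves split at `3` that are neither MONO-carrier (print) nor a `KatoFrame` with `E(ℚ₃)[3] = 0` —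
i.e. (v3) the `f ≥ 1` frames (`3 ∣ #E(ℚ₃)_tors`: Kato's class is `3^f` too divisible, S1's ledger), and the curves
with ≥ 2 Tamagawa-`3` carriers off `3`, where EVERY Kolyvagin-system method sees `max_ℓ v₃(c_ℓ)`, not `Σ_ℓ` (catalogued
barrier `Literature.Barriers.BirchSwinnertonDyer.StringentKolyvaginCapsAtMax`; Büyükboduk 2009 §4.2 Question 1;
inert r9's `stub_coStepLResidualShapeAtThree` ∕ saving display are the typed roads there).  WHY IT MIGHT FAIL: it
is a slice of an open crux.  [cite: Buyukboduk2009TamagawaDefect, §4.2 Question 1] [cite: Jetchev2008, Thm. 1.4] -/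
theorem stub_offKatoPopulationAtThree :
    ∀ (W : WeierstrassCurve ℚ) [W.IsElliptic] [W.IsGloballyMinimal], ClassX11b W 3 →
      ((Surj W 3 ∧ ¬ Ram W 3) ∨
        (Ram W 3 ∧ W.HasSplitMultiplicativeReductionAtPrime 3 ∧
          (¬ ∃ v : HeightOneSpectrum (𝓞 ℚ), padicValNat 3 W.tamagawaProduct ≤ padicValNat 3 (W.tamagawaNumberAt v)) ∧
          ¬ ((∀ w : HeightOneSpectrum (𝓞 ℚ), ((3 : ℕ) : 𝓞 ℚ) ∈ w.asIdeal →
              ∀ Q : (W.baseChange (w.adicCompletion ℚ)).toAffine.Point, 3 • Q = 0 → Q = 0) ∧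
            ∃ (ℓ : HeightOneSpectrum (𝓞 ℚ)) (n : ℕ),
            (ClassX11b W 3 ∧ Ram W 3 ∧ W.HasSplitMultiplicativeReductionAtPrime 3 ∧
              ((3 : ℕ) : 𝓞 ℚ) ∉ ℓ.asIdeal ∧ padicValNat 3 (W.tamagawaNumberAt ℓ) = n + 1 ∧
              ∀ v : HeightOneSpectrum (𝓞 ℚ), ((3 : ℕ) : 𝓞 ℚ) ∉ v.asIdeal → v ≠ ℓ → ¬ 3 ∣ W.tamagawaNumberAt v)))) →
      Typed.MissingUpperBoundAt W 3 := by
  sorry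

/-! ## §2 PROVED: the Tamagawa defect at the one carrier (S3, from the tree's TOOL theorem) and the
numerical glue -/

/-- **S3 (PROVED, not a stub): the one-place TAMAGAWA DEFECT**, `3^{n+1} ∣ c_ℓ` at ONE finite `ℓ ∤ 3`:
every Kolyvagin system for `𝓕_u` on `E[3^{k+n+2}]` is `incl_*` of a Kolyvagin system for `𝓕_can` on
`E[3^{k+1}]` — the tree's `KimAtThreeD7uTamagawaSharp.exists_isKolyvaginSystem_map_torsionInclusion_eq_add_le`
(parts IX–XXI of the TAMAGAWA-DIVISIBLE series) read on the bundled data.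
[cite: Buyukboduk2009TamagawaDefect, Thm. 3.1] [cite: MazurRubin2004, App. A Remark A.5] -/
theorem tamagawaDefect_of_canonicalTowerData (W : WeierstrassCurve ℚ) [W.IsElliptic]
    [Finite (geomTorsion W ((3 : ℕ) : ℤ))] [Finite (geomTorsion W (((3 : ℕ) : ℤ) ^ 0 * ((3 : ℕ) : ℤ)))]
    (k n : ℕ) {ℓ : HeightOneSpectrum (𝓞 ℚ)} (h3ℓ : ((3 : ℕ) : 𝓞 ℚ) ∉ ℓ.asIdeal)
    (hn : 3 ^ (n + 1) ∣ W.tamagawaNumberAt ℓ) (𝔇 : CanonicalTowerData W (k + n + 1))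
    {κ : Finset (HeightOneSpectrum (𝓞 ℚ)) →
      galoisCohomology (W.torsionGaloisModule (((3 : ℕ) : ℤ) ^ (k + n + 1) * ((3 : ℕ) : ℤ))) 1}
    (hκ : (𝔇.D (k + n + 1)).IsKolyvaginSystem
      (blochKatoSelmerStructure 3 (tateTorsionDatum W 3 (k + n + 1)) (fun _ _ => ⊤)) κ) :
    ∃ lam : Finset (HeightOneSpectrum (𝓞 ℚ)) →
        galoisCohomology (W.torsionGaloisModule (((3 : ℕ) : ℤ) ^ k * ((3 : ℕ) : ℤ))) 1,
      (𝔇.D k).IsKolyvaginSystem (propagatedSelmerStructure W 3 k) lam ∧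
        ∀ d, galoisCohomology.map (W.torsionInclusion (pow_mul_dvd_pow_mul_of_le 3 (le_add_add_one k n))) 1
          (lam d) = κ d :=
  Summit.BirchSwinnertonDyer.BirchSwinnertonDyer.Theorems.KimAtThreeD7uTamagawaSharp.exists_isKolyvaginSystem_map_torsionInclusion_eq_add_le
    W 𝔇.hperf 𝔇.hsum 𝔇.hcompl 𝔇.hEP 𝔇.T 𝔇.h3T 𝔇.hbadT k n h3ℓ hn 𝔇.h0 𝔇.hτ 𝔇.hτ₁ 𝔇.hτμ 𝔇.D 𝔇.hP 𝔇.hPT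
    𝔇.hPc 𝔇.hT 𝔇.hD 𝔇.hadm 𝔇.hprime hκ

/-- `3^{k+1}` kills `H¹(ℚ, E[3^{k+1}])`, so every class has finite order. [folklore] -/
theorem isOfFinAddOrder_galoisCohomology_torsion (W : WeierstrassCurve ℚ) (k : ℕ)
    (x : galoisCohomology (W.torsionGaloisModule (((3 : ℕ) : ℤ) ^ k * ((3 : ℕ) : ℤ))) 1) :
    IsOfFinAddOrder x := by
  have hx : 3 ^ (k + 1) • x = 0 :=
    galoisCohomology.nsmul_eq_zero_of_forall _ (fun T => by
      have h := W.natAbs_nsmul_geomTorsion T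
      rwa [show (((3 : ℕ) : ℤ) ^ k * ((3 : ℕ) : ℤ)).natAbs = 3 ^ (k + 1) by
        rw [Int.natAbs_mul, Int.natAbs_pow, Int.natAbs_natCast, pow_succ]] at h) x
  exact isOfFinAddOrder_iff_nsmul_eq_zero.mpr ⟨3 ^ (k + 1), pow_pos (by norm_num) _, hx⟩

/-- Orders in Galois cohomology divide along `incl_*`: `ord (incl_* x) ∣ ord x`, in valuation form. [folklore] -/
theorem padicValNat_addOrderOf_map_le {A B : Type*} [AddCommGroup A] [AddCommGroup B] (f : A →+ B) (x : A)
    (hx : IsOfFinAddOrder x) :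
    padicValNat 3 (addOrderOf (f x)) ≤ padicValNat 3 (addOrderOf x) := by
  haveI : Fact (Nat.Prime 3) := ⟨Nat.prime_three⟩
  have hdvd : addOrderOf (f x) ∣ addOrderOf x := addOrderOf_map_dvd f x
  have hpos : 0 < addOrderOf x := hx.addOrderOf_pos
  exact (padicValNat_dvd_iff_le (p := 3) hpos.ne').mp (dvd_trans pow_padicValNat_dvd hdvd)

/-- **THE GLUE (PROVED): the Kato road on a frame.**  S0 (data) + S1 (Kato's class, the bet) + S3 (defect,
proved) + S2 (Sakamoto's bound + bookkeeping) ⟹ `Typed.MissingUpperBoundAt W 3`: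
`k+1 ≤ v₃(ord κ_∅) + i + v₃#Ш_an ≤ v₃(ord λ_∅) + i + v₃#Ш_an ≤ (k + 1 − i − m) + i + v₃#Ш_an`, so `m ≤ v₃ #Ш_an`,
and `Typed.missingUpperBoundAt_of_stable` (Ш finite by GZK on the class). [cite: MazurRubin2004, Thm. 5.2.12] -/
theorem missingUpperBoundAt_three_of_katoRoad
    (hGZK : Literature.NumberTheory.EllipticCurves.rank_eq_analyticRank_of_analyticRank_le_one)
    (hPT : poitouTate_selmerStructure_duality ℚ)
    (hEP : ∀ v : HeightOneSpectrum (𝓞 ℚ), localEulerPoincareCharacteristic (v.adicCompletion ℚ))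
    (W : WeierstrassCurve ℚ) [W.IsElliptic] [W.IsGloballyMinimal]
    (ℓ : HeightOneSpectrum (𝓞 ℚ)) (n : ℕ)
    (hF : (ClassX11b W 3 ∧ Ram W 3 ∧ W.HasSplitMultiplicativeReductionAtPrime 3 ∧
        ((3 : ℕ) : 𝓞 ℚ) ∉ ℓ.asIdeal ∧ padicValNat 3 (W.tamagawaNumberAt ℓ) = n + 1 ∧
        ∀ v : HeightOneSpectrum (𝓞 ℚ), ((3 : ℕ) : 𝓞 ℚ) ∉ v.asIdeal → v ≠ ℓ → ¬ 3 ∣ W.tamagawaNumberAt v))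
    (h3t : ∀ w : HeightOneSpectrum (𝓞 ℚ), ((3 : ℕ) : 𝓞 ℚ) ∈ w.asIdeal →
      ∀ Q : (W.baseChange (w.adicCompletion ℚ)).toAffine.Point, 3 • Q = 0 → Q = 0)
    {q : ℚ} (hq : shaAn W = (q : ℂ)) : Typed.MissingUpperBoundAt W 3 := by
  haveI : Fact (Nat.Prime 3) := ⟨Nat.prime_three⟩
  haveI : Finite (geomTorsion W ((3 : ℕ) : ℤ)) :=
    finite_torsionPoints_holds W (AlgebraicClosure ℚ) (by norm_num)
  haveI : Finite (geomTorsion W (((3 : ℕ) : ℤ) ^ 0 * ((3 : ℕ) : ℤ))) := finite_geomTorsion_pow_mul W 3 0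
  have hX : ClassX11b W 3 := hF.1
  have hram : Ram W 3 := hF.2.1
  have h3ℓ : ((3 : ℕ) : 𝓞 ℚ) ∉ ℓ.asIdeal := hF.2.2.2.1
  have hvℓ : padicValNat 3 (W.tamagawaNumberAt ℓ) = n + 1 := hF.2.2.2.2.1
  have hn : 3 ^ (n + 1) ∣ W.tamagawaNumberAt ℓ := hvℓ ▸ pow_padicValNat_dvd
  -- S2: the local index, the stabilisation of Ш[3^∞], Sakamoto's bound
  obtain ⟨i, k', m, k₀, hidx, hstab, hcard, hbound⟩ := stub_kolyvaginBoundCanonicalAtThree hGZK W ℓ n hF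
  -- S1: Kato's Kolyvagin system with controlled bottom class
  obtain ⟨k₁, hkato⟩ := katoDerivedClassAtThree W ℓ n hF h3t i hidx q hq
  -- work at level k = max k₀ k₁, data at level k + n + 1 (S0)
  set k : ℕ := max k₀ k₁ with hk
  obtain ⟨𝔇⟩ := canonicalTowerDataAtThree hPT hEP W hX hram (k + n + 1)
  obtain ⟨κ, hκ, hineq⟩ := hkato k (le_max_right _ _) 𝔇
  -- S3: the defect — κ = incl_* λ with λ a Kolyvagin system for 𝓕_can on E[3^{k+1}]
  obtain ⟨lam, hlam, hmap⟩ := tamagawaDefect_of_canonicalTowerData W k n h3ℓ hn 𝔇 hκ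
  -- the bound for λ
  have hb : padicValNat 3 (addOrderOf (lam ∅)) + i + m ≤ k + 1 :=
    hbound (k + n + 1) 𝔇 k (le_max_left _ _) (by omega) lam hlam
  -- ord κ_∅ ∣ ord λ_∅
  have hfin : IsOfFinAddOrder (lam ∅) := isOfFinAddOrder_galoisCohomology_torsion W k (lam ∅)
  have hle : padicValNat 3 (addOrderOf (κ ∅)) ≤ padicValNat 3 (addOrderOf (lam ∅)) := by
    rw [← hmap ∅]
    exact padicValNat_addOrderOf_map_le _ _ hfin
  -- arithmetic: m ≤ v₃(q)
  have hv : (m : ℤ) ≤ padicValRat 3 q := by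
    have h1 : ((k + 1 : ℕ) : ℤ) ≤ (padicValNat 3 (addOrderOf (lam ∅)) : ℤ) + i + padicValRat 3 q := by
      calc ((k + 1 : ℕ) : ℤ) ≤ (padicValNat 3 (addOrderOf (κ ∅)) : ℤ) + i + padicValRat 3 q := hineq
        _ ≤ (padicValNat 3 (addOrderOf (lam ∅)) : ℤ) + i + padicValRat 3 q := by
          have : (padicValNat 3 (addOrderOf (κ ∅)) : ℤ) ≤ (padicValNat 3 (addOrderOf (lam ∅)) : ℤ) := by
            exact_mod_cast hle
          linarith
    have h2 : ((padicValNat 3 (addOrderOf (lam ∅)) + i + m : ℕ) : ℤ) ≤ ((k + 1 : ℕ) : ℤ) := by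
      exact_mod_cast hb
    push_cast at h1 h2
    linarith
  -- Ш finite on the class (GZK), then the stabilised certificate
  have hShafin : W.ShaFinite := (hGZK W (by rw [hX.1])).2
  exact Typed.missingUpperBoundAt_of_stable W 3 hShafin hstab hcard hq hv

/-! ## §3 The composition: the crux BY NAME -/

/-- **stub F (CITABLE bundle, by Literature decl name ∕ print; S-sized each): the print inputs off the route's
`PublishedInputsThree`** — McCallum 1991 Prop. 5.2 ∕ Prop. 4.4 ∕ Cor. 5.6-upper (the three named facts the
MONO-carrier print theorem consumes; inert r9 derives the last two from Cassels–Tate level inputs + Gross 1991),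
Poitou–Tate duality for Selmer structures with a conjugation-compatible family (every number field; inert r9's
`hPT_of_localFactsAtThree` derives it from `SelmerComplement` of the canonical invariants), Gross 1991 (3.3)
(`P_n − [u_n]P_K^{σ-avg} ∈ E⁰`), Tate's local Euler–Poincaré characteristic at every finite place of `ℚ`
(NSW (7.3.1); Milne ADT I.2.8), and the RATIONALITY of `#Ш_an` on the class (`L'(E,1)/(Ω·Reg) ∈ ℚ` in analytic
rank one: Gross–Zagier 1986 I (6.5) with V (2.1)).  [cite: McCallumLMS1991, Prop. 5.2, Prop. 4.4, Cor. 5.6]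
[cite: MilneADT2006, I Thm. 2.8, Thm. 4.10] [cite: GrossLMS1991, (3.3)] [cite: GrossZagier1986, I (6.5), V (2.1)] -/
theorem stub_printFactsAtThree :
    McCallum1991.prop52_exists_conductor_kolyvaginClass_order_eq ∧
    McCallum1991.prop44_localOrder_kolyvaginClass_mul_eq ∧
    McCallum1991_padicValNat_card_sha_primary_add_le_of_globalDivisibility ∧
    (∀ (K : Type) [Field K] [NumberField K], poitouTate_selmerStructure_duality_conj K) ∧
    Gross1991_heegnerPoint_sub_ratTorsion_mem_E0 ∧
    (∀ v : HeightOneSpectrum (𝓞 ℚ), localEulerPoincareCharacteristic (v.adicCompletion ℚ)) ∧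
    (∀ (W : WeierstrassCurve ℚ) [W.IsElliptic] [W.IsGloballyMinimal], ClassX11b W 3 →
      ∃ q : ℚ, shaAn W = (q : ℂ)) := by
  sorry

/-- **Crux 19109 from the line** — the route's `PublishedInputsThree` (by name: its conjunct GZK is the only one
consumed here directly; the mono-carrier PRINT theorem consumes the rest), the citable bundle F, the three stubs
S0 S1 S2, the proved defect S3 and glue, and the residual R.  Per curve: clause (3) and the (ram)-split curves
with ≥ 2 carriers off `3` → R; MONO-carrier (ram) curves → PRINT
(`Koly.missingUpperBoundAt_three_of_classX11b_of_ram_of_monoCarrier_of_print`); `KatoFrame` curves → the Kato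
road.  Clause (1): split from shape (α); clause (2): split given. -/
theorem EulerHalvesAtThree_of
    (h : Summit.BirchSwinnertonDyer.BirchSwinnertonDyer.Theses.ClassRecordThree.PublishedInputsThree) :
    Summit.BirchSwinnertonDyer.BirchSwinnertonDyer.Theses.ClassRecordThree.EulerHalvesAtThree := by
  have hGZK : Literature.NumberTheory.EllipticCurves.rank_eq_analyticRank_of_analyticRank_le_one := by
    obtain ⟨-, -, -, -, -, hGZK, -⟩ := h
    exact hGZK
  obtain ⟨h52, h44, hMcU, hPTK, hF1, hEP, hrat⟩ := stub_printFactsAtThree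
  have hPT : poitouTate_selmerStructure_duality ℚ := poitouTate_selmerStructure_duality_of_conj (hPTK ℚ)
  intro W _ _ hX
  -- the (ram) ∧ split dispatcher
  have hramSplit : Ram W 3 → W.HasSplitMultiplicativeReductionAtPrime 3 → Typed.MissingUpperBoundAt W 3 := by
    intro hram hsplit
    by_cases hmono : ∃ v : HeightOneSpectrum (𝓞 ℚ),
        padicValNat 3 W.tamagawaProduct ≤ padicValNat 3 (W.tamagawaNumberAt v)
    · exact Summit.BirchSwinnertonDyer.Rank1Residual.X11b.Three.Koly.missingUpperBoundAt_three_of_classX11b_of_ram_of_monoCarrier_of_print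
        h h52 h44 hMcU hPTK hF1 W hX hram hmono
    by_cases hKF : (∀ w : HeightOneSpectrum (𝓞 ℚ), ((3 : ℕ) : 𝓞 ℚ) ∈ w.asIdeal →
          ∀ Q : (W.baseChange (w.adicCompletion ℚ)).toAffine.Point, 3 • Q = 0 → Q = 0) ∧
        ∃ (ℓ : HeightOneSpectrum (𝓞 ℚ)) (n : ℕ),
        (ClassX11b W 3 ∧ Ram W 3 ∧ W.HasSplitMultiplicativeReductionAtPrime 3 ∧
            ((3 : ℕ) : 𝓞 ℚ) ∉ ℓ.asIdeal ∧ padicValNat 3 (W.tamagawaNumberAt ℓ) = n + 1 ∧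
            ∀ v : HeightOneSpectrum (𝓞 ℚ), ((3 : ℕ) : 𝓞 ℚ) ∉ v.asIdeal → v ≠ ℓ → ¬ 3 ∣ W.tamagawaNumberAt v)
    · obtain ⟨h3t, ℓ, n, hF⟩ := hKF
      obtain ⟨q, hq⟩ := hrat W hX
      exact missingUpperBoundAt_three_of_katoRoad hGZK hPT hEP W ℓ n hF h3t hq
    · exact stub_offKatoPopulationAtThree W hX (Or.inr ⟨hram, hsplit, hmono, hKF⟩)
  refine ⟨fun hram hα => hramSplit hram hα.1, fun hram hsplit _ _ => hramSplit hram hsplit,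
    fun hsurj hnram => stub_offKatoPopulationAtThree W hX (Or.inl ⟨hsurj, hnram⟩)⟩

/-- **The `KolyvaginRoadThree` twin** (same statement, shared item 19109). -/
theorem EulerHalvesAtThree_of'
    (h : Summit.BirchSwinnertonDyer.BirchSwinnertonDyer.Theses.ClassRecordThree.PublishedInputsThree) :
    Summit.BirchSwinnertonDyer.BirchSwinnertonDyer.Theses.KolyvaginRoadThree.EulerHalvesAtThree :=
  fun W _ _ hX => EulerHalvesAtThree_of h W hX

end Summit.BirchSwinnertonDyer.BirchSwinnertonDyer.Cruxes.EulerHalvesAtThree.KatoDefect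

end
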